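import Literature.Probability.Percolation.FivePointCornerToggle
import Literature.Probability.Percolation.FivePointHolomorphy
import Mathlib.RingTheory.RootsOfUnity.Complex
import HarnessLib

/-!
# Five-point discrete holomorphicity at the BOUNDARY vertices of `H_G`, for every five-marked domain

Topic `Literature/Probability/Percolation`; lane pcv-sawmu (CriticalPhenomena), door (v) / cell «(H∂)» (b-engine-2 g8). The tree's
theorem `N5.hexFivePointHolomorphy_holds` (`FivePointHolomorphy.lean`) proves `Σ_{k : Fin 3} τ^k F_j(v, ccwNbr v k) = 0` at every
INTERIOR vertex `v` of `H_Ω` (a face of `𝕋` with all three sites in `G`). Khristoforov–Smirnov's printed Lemma 4 (three boundary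
disorders) asks only that the three mid-edges at `v` are mid-edges of `Ω` — in the tree's vocabulary: that the three SIDES of `v` are
bonds of `H_G`, i.e. at least two of the three sites of `v` lie in `G`. This file proves the five-point relation under exactly that
hypothesis (`AllSides D v`), which adds the valence-3 BOUNDARY vertices of `H_G` (two sites in `G`; two of the three edges are boundary
edges, possibly ending at a corner face `y_i`).

Method. The tree's core-triple proof (HT1 core decomposition, HT2 invariant triples, HT3 re-linking triples, HT4 triple algebra,
assembly) re-run over the BOUNDARY six-odd-point spaces `Bdry.loopSpace6b` of `FivePointBoundaryValues.lean` (XOR parity «odd faces =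
corners Δ {s}», needed when a neighbour of `v` is a corner face) with the boundary transport `Bdry.sixTransport_b` and structure
`Bdry.sixStructure_gen`; cores carry the parity `corners Δ {odd neighbours}`; a neighbour of `v` that is a corner face is isolated in
every core and is its own partner in HT3.

Status in print (lane label cell, lit-2 g14, 2026-08-23). The HYPOTHESIS is Khristoforov–Smirnov 2021, §2 Lemma 4 (Discrete
holomorphicity) verbatim — «Let z₁, z₂, z₃ ∈ E^mid_∘(Ω) be three mid-edges around a vertex v indexed in the counterclockwise order, then
Σ_{k=1}^{3} τ^k F(z_k) = 0», where E^mid_∘(Ω) is the set of mid-edges of Ω other than the marks (arXiv:2111.15612v1, p. 4; the only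
condition on v is that its three mid-edges are sides of hexagons of Ω, boundary vertices included) — in the tree's site language «all three
sides of v are H_G-bonds» ⟺ «at least two of the three sites of v lie in G» (`AllSides`). The five-mark RELATION itself is not located in
print in any form (labels of (N)/(H) of record): (H∂) is new at five marks, of the same class as the tree's (H), now at the printed
vertex-generality of KhS21 Lemma 4 (the tree's (H) was the interior-vertex case, Bollobás–Riordan's «faces of the discrete domain»,
Ch. 7 Lemma 12). Proof organisation ours: KhS's one-sentence triple argument does not distinguish boundary vertices (mid-edge disorders
make the triple bijection uniform); the lane's corner-FACE disorders force the extra case (a corner-face neighbour is isolated in every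
core and is its own partner), handled here. Data behind the statement: lane pre-registration MINING-PREREG Am. AN «P-HD» (TRUE 4/4, two
independent enumerators, 1 080 boundary (vertex, colour, j) cells on nine domains incl. three fresh shapes, exact ℤ[τ]).

## References
* M. Khristoforov, S. Smirnov, *Percolation and O(1) loop model*, arXiv:2111.15612 (2021), §1.2 (pp. 2–4) and §2 Definition 3,
  Lemma 4 (p. 4), Corollary 5 (p. 5).
* B. Bollobás, O. Riordan, *Percolation*, Cambridge University Press (2006), Ch. 7 §7.2.2 pp. 168–171, Lemma 12 p. 180.
-/

open Finset

namespace Literature.Probability.Percolation.FivePoint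

open Finset Literature.Probability.Percolation Literature.Probability.LatticeModels Literature.Probability.Percolation.FivePoint TriMarkedDomain

namespace BdryH

open N5 Bdry

variable (D : TriMarkedDomain 5)

/-! ## Part A0. The hypothesis «all three sides of `v` are bonds of `H_G`» and its consequences -/

/-- all three sides of the face `v` are bonds of `H_G` (⟺ at least two of the three sites of `v` lie in `G`): the printed hypothesis
«the three mid-edges at `v` are mid-edges of `Ω`» of Khristoforov–Smirnov's Lemma 4. [cite: KhristoforovSmirnov2021, §2 Lemma 4 (p. 4)] -/
def AllSides (v : HexVertex) : Prop := ∀ i : Fin 3, side v i ∈ hBonds D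

/-! ## Definitions (explicit domain): boundary spaces at the edges of `v`, boundary cores, classes, counts, weights -/

/-- the BOUNDARY six-odd-point space at the `k`-th edge of `v` with odd endpoint `s` (`Bdry.loopSpace6b` for the bond `side v k`). [cite: KhristoforovSmirnov2021, §1.2 (loop configurations, pp. 2–4)] -/
noncomputable def T6b (v : HexVertex) (k : Fin 3) (s : HexVertex) : Finset (Finset (Sym2 (Site 2))) :=
  loopSpace6b D (faceVertex v (k + 1)) (faceVertex v (k + 2)) s

/-- a BOUNDARY CORE at `v` with odd-neighbour index set `S` (`|S|` odd): an edge set avoiding the sides of `v` whose odd touching faces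
are the corners XOR the neighbours `oppFace v i`, `i ∈ S` (a neighbour that is a corner face and lies in `S` is EVEN). [cite: KhristoforovSmirnov2021, Lemma 4 (discrete holomorphicity: the triple bijection at a vertex)] -/
def IsCoreb (v : HexVertex) (S : Finset (Fin 3)) (ζ : Finset (Sym2 (Site 2))) : Prop :=
  ζ ⊆ Eminus D v ∧ Odd S.card ∧ ParityIs D ζ (symmDiff (corners D) (S.image (oppFace v)))

/-- the class predicate of the completion at `k`, in the boundary space. [cite: KhristoforovSmirnov2021, Lemma 4 (discrete holomorphicity: the triple bijection at a vertex)] -/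
def ComplClassb (v : HexVertex) (S : Finset (Fin 3)) (k : Fin 3) (ζ : Finset (Sym2 (Site 2))) (r : Fin 5) (m : Bool) : Prop :=
  InClassb D (faceVertex v (k + 1)) (faceVertex v (k + 2)) (coreEnd v S k) r m (coreCompl v S k ζ)

open Classical in
/-- the boundary class count `W∂_{r,M}` at the `k`-th edge of `v` (both odd endpoints). [cite: KhristoforovSmirnov2021, Lemma 4 (discrete holomorphicity: the triple bijection at a vertex)] -/
noncomputable def Wcb (v : HexVertex) (k : Fin 3) (r : Fin 5) (m : Bool) : ℕ :=
  #((T6b D v k v).filter fun ξ => InClassb D (faceVertex v (k + 1)) (faceVertex v (k + 2)) v r m ξ) +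
    #((T6b D v k (oppFace v k)).filter fun ξ => InClassb D (faceVertex v (k + 1)) (faceVertex v (k + 2)) (oppFace v k) r m ξ)

/-- the per-configuration weight at the `k`-th edge of `v` with odd endpoint `s`, boundary classes. [cite: KhristoforovSmirnov2021, Lemma 4 (discrete holomorphicity: the triple bijection at a vertex)] -/
noncomputable def Gkb (v : HexVertex) (k : Fin 3) (j : Fin 5) (s : HexVertex) (ξ : Finset (Sym2 (Site 2))) : ℂ :=
  gphi j fun r m => InClassb D (faceVertex v (k + 1)) (faceVertex v (k + 2)) s r m ξ

open Classical in
/-- the boundary cores at `v`, as a finset of pairs `(S, ζ)`. [cite: KhristoforovSmirnov2021, Lemma 4 (discrete holomorphicity: the triple bijection at a vertex)] -/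
noncomputable def coreSetb (v : HexVertex) : Finset (Finset (Fin 3) × Finset (Sym2 (Site 2))) :=
  ((Finset.univ : Finset (Finset (Fin 3))) ×ˢ (Eminus D v).powerset).filter fun q => IsCoreb D v q.1 q.2

variable {D}

/-- two of the three sites in `G` give all sides in `H_G`. [cite: KhristoforovSmirnov2021, §2 Lemma 4 (p. 4)] -/
theorem allSides_of_two_le {v : HexVertex} (h : 2 ≤ #((hexFaceVertices v).filter (· ∈ D.verts))) : AllSides D v := by
  classical
  intro i
  by_contra hnot
  have h1 : faceVertex v (i + 1) ∉ D.verts := fun hm =>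
    hnot (mem_hBonds D (by have := adj_faceVertex_succ v (i + 1); rwa [add_assoc] at this) (Or.inl hm))
  have h2 : faceVertex v (i + 2) ∉ D.verts := fun hm =>
    hnot (mem_hBonds D (by have := adj_faceVertex_succ v (i + 1); rwa [add_assoc] at this) (Or.inr hm))
  have hsub : (hexFaceVertices v).filter (· ∈ D.verts) ⊆ {faceVertex v i} := by
    intro x hx
    rw [Finset.mem_filter, hexFaceVertices_eq_triple v i] at hx
    rw [Finset.mem_singleton]
    rcases Finset.mem_insert.1 hx.1 with e | e
    · exact e
    rcases Finset.mem_insert.1 e with e | e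
    · exact absurd (e ▸ hx.2) h1
    · rw [Finset.mem_singleton] at e; exact absurd (e ▸ hx.2) h2
  have := (Finset.card_le_card hsub).trans (Finset.card_singleton _).le
  omega

/-- an interior face has all sides in `H_G`. [cite: KhristoforovSmirnov2021, §2 Lemma 4 (p. 4)] -/
theorem allSides_of_subset {v : HexVertex} (hv : hexFaceVertices v ⊆ D.verts) : AllSides D v :=
  fun i => h1_side_mem_hBonds D hv i

section Facts

variable {v : HexVertex} (hv : AllSides D v)
include hv

/-- the face touches `G`. [cite: KhristoforovSmirnov2021, §2 Lemma 4 (p. 4)] -/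
theorem hb_v_touching : v ∈ triFacesTouching D.verts := mem_touching_of_side_mem D (hv 0)

/-- the neighbours touch `G`. [cite: KhristoforovSmirnov2021, §2 Lemma 4 (p. 4)] -/
theorem hb_opp_touching (i : Fin 3) : oppFace v i ∈ triFacesTouching D.verts := by
  have h := hv i
  rw [← side_oppFace_oppIdx v i] at h
  exact mem_touching_of_side_mem D h

/-- the face is not a corner face (corner faces have a side off `H_G`). [cite: BollobasRiordan2006, Ch. 7 §7.2.2 pp. 168–171] -/
theorem hb_v_not_corner : v ∉ corners D := by
  intro hc
  obtain ⟨i, hi⟩ := (mem_corners D).1 hc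
  obtain ⟨j, hj⟩ := exists_side_not_mem_hBonds_of_corner D ((isCornerFace_iff_eq_yc D).2 hi)
  exact hj (hv j)

/-- no corner is the face. [cite: BollobasRiordan2006, Ch. 7 §7.2.2 pp. 168–171] -/
theorem hb_yc_ne_v (a : Fin 5) : yc D a ≠ v := fun e => hb_v_not_corner hv (e ▸ (mem_corners D).2 ⟨a, rfl⟩)

/-- one endpoint of each side lies in `G`. [cite: KhristoforovSmirnov2021, §2 Lemma 4 (p. 4)] -/
theorem hb_exists_mem (i : Fin 3) :
    (faceVertex v (i + 1) ∈ D.verts) ∨ (faceVertex v (i + 2) ∈ D.verts) := by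
  obtain ⟨a, b, he, ha, -⟩ := exists_rep_of_mem_hBonds D (hv i)
  unfold side at he
  rcases Sym2.eq_iff.1 he with ⟨h1, -⟩ | ⟨-, h2⟩
  · exact Or.inl (h1 ▸ ha)
  · exact Or.inr (h2 ▸ ha)

end Facts

/-! ## Part A1. Parity algebra: sets of sides of `v`, XOR -/

open Classical in
/-- **parity of a set of sides of `v`** (the tree's `h1_odd_xiDeg_sides` under `AllSides`). [cite: KhristoforovSmirnov2021, Lemma 4 (discrete holomorphicity: the triple bijection at a vertex)] -/
theorem hb_odd_xiDeg_sides {v : HexVertex} (hv : AllSides D v) (I : Finset (Fin 3)) {F : HexVertex}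
    (hF : F ∈ triFacesTouching D.verts) :
    Odd (xiDeg (I.image (side v)) F) ↔ ((F = v ∧ Odd I.card) ∨ ∃ i ∈ I, F = oppFace v i) := by
  induction I using Finset.induction_on with
  | empty =>
    have h0 : xiDeg ((∅ : Finset (Fin 3)).image (side v)) F = 0 := by
      rw [Finset.image_empty, l1_xiDeg_eq, Finset.card_eq_zero, Finset.filter_eq_empty_iff]
      intro j _ hj; exact absurd hj (Finset.notMem_empty _)
    rw [h0]
    simp
  | insert i I hi ih =>
    have hnot : side v i ∉ I.image (side v) := by
      rw [Finset.mem_image]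
      rintro ⟨i', hi', he⟩
      exact hi (side_injective v he ▸ hi')
    have hsd : (insert i I).image (side v) = symmDiff {side v i} (I.image (side v)) := by
      rw [Finset.image_insert]
      ext b
      rw [Finset.mem_insert, Finset.mem_symmDiff, Finset.mem_singleton]
      constructor
      · rintro (rfl | h)
        · exact Or.inl ⟨rfl, hnot⟩
        · exact Or.inr ⟨h, fun e => hnot (e ▸ h)⟩
      · rintro (⟨rfl, -⟩ | ⟨h, -⟩)
        · exact Or.inl rfl
        · exact Or.inr h
    rw [hsd, xorDeg_holds, l1_odd_xiDeg_singleton_iff, l3_exists_side_eq_iff D (hv i) hF, ih,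
      Finset.card_insert_of_notMem hi, Nat.odd_add_one, Finset.exists_mem_insert]
    have hne : v ≠ oppFace v i := h1_ne_oppFace v i
    have hnoI : ¬ ∃ i' ∈ I, oppFace v i = oppFace v i' := by
      rintro ⟨i', hi', he⟩; exact hi (oppFace_injective' v he ▸ hi')
    have hnov : ¬ ∃ i' ∈ I, v = oppFace v i' := by
      rintro ⟨i', -, he⟩; exact h1_ne_oppFace v i' he
    by_cases hFv : F = v
    · rw [hFv]
      simp [hne, hnov]
    · by_cases hFi : F = oppFace v i
      · rw [hFi]
        simp [hne.symm, hnoI]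
      · simp [hFv, hFi]

/-- XOR of membership is membership in the symmetric difference. [folklore] -/
private theorem mem_symmDiff_iff_not_iff {α : Type*} [DecidableEq α] (s t : Finset α) (a : α) :
    a ∈ symmDiff s t ↔ ¬ (a ∈ s ↔ a ∈ t) := by
  rw [Finset.mem_symmDiff]; tauto

/-- `Xor` with the corner predicate is membership in `corners Δ {s}`. [cite: KhristoforovSmirnov2021, §1.2 (loop configurations, pp. 2–4)] -/
theorem xor_corner_iff_mem_symmDiff (s F : HexVertex) :
    Xor (∃ j : Fin 5, IsCornerFace D j F) (F = s) ↔ F ∈ symmDiff (corners D) ({s} : Finset HexVertex) := by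
  classical
  rw [h1_mem_corners_iff, Finset.mem_symmDiff, Finset.mem_singleton]
  rfl

/-- the three-way XOR bookkeeping behind HT1. [folklore] -/
private theorem prop_par₁ {c si pr es : Prop} (h : Xor si pr ↔ es) : (¬ (¬ (c ↔ si) ↔ pr)) ↔ ¬ (c ↔ es) := by
  unfold Xor at *; tauto

/-- … and its inverse reading. [folklore] -/
private theorem prop_par₂ {c si pr es : Prop} (h : Xor si pr ↔ es) : (¬ (¬ (c ↔ es) ↔ pr)) ↔ ¬ (c ↔ si) := by
  unfold Xor at *; tauto

/-- **the key XOR at `v`**: for `S` odd, «`F` is an odd neighbour» XOR «`F` is odd for the sides `S ∖ {k}`» iff `F` is the odd endpoint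
`coreEnd v S k`. [cite: KhristoforovSmirnov2021, Lemma 4 (discrete holomorphicity: the triple bijection at a vertex)] -/
theorem hb_xor_key (v : HexVertex) {S : Finset (Fin 3)} (hodd : Odd S.card) (k : Fin 3) (F : HexVertex) :
    Xor (∃ i ∈ S, F = oppFace v i) ((F = v ∧ Odd (S.erase k).card) ∨ ∃ i ∈ S.erase k, F = oppFace v i) ↔ F = coreEnd v S k := by
  classical
  have hvo : ∀ i : Fin 3, v ≠ oppFace v i := h1_ne_oppFace v
  have hcard : Odd (S.erase k).card ↔ k ∉ S := by
    by_cases hk : k ∈ S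
    · rw [Finset.card_erase_of_mem hk]
      obtain ⟨m, hm⟩ := hodd
      rw [hm, Nat.add_sub_cancel]
      exact ⟨fun ho => absurd ho (by rw [Nat.odd_iff]; omega), fun h => absurd hk h⟩
    · rw [Finset.erase_eq_of_notMem hk]; exact ⟨fun _ => hk, fun _ => hodd⟩
  unfold coreEnd Xor
  by_cases hFv : F = v
  · subst hFv
    have hno : ¬ ∃ i ∈ S, F = oppFace F i := fun ⟨i, _, e⟩ => hvo i e
    have hno' : ¬ ∃ i ∈ S.erase k, F = oppFace F i := fun ⟨i, _, e⟩ => hvo i e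
    simp only [hno, hno', or_false, true_and, hcard, false_and, not_false_eq_true, and_true, false_or]
    split_ifs with h
    · exact ⟨fun h' => absurd h h', fun e => absurd e (hvo k)⟩
    · exact ⟨fun _ => rfl, fun _ => h⟩
  · by_cases hFo : ∃ i : Fin 3, F = oppFace v i
    · obtain ⟨i, rfl⟩ := hFo
      have him : (∃ i' ∈ S, oppFace v i = oppFace v i') ↔ i ∈ S := by
        constructor
        · rintro ⟨i', hi', e⟩; exact oppFace_injective' v e ▸ hi'
        · intro h; exact ⟨i, h, rfl⟩
      have hex : (∃ i' ∈ S.erase k, oppFace v i = oppFace v i') ↔ (i ≠ k ∧ i ∈ S) := by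
        constructor
        · rintro ⟨i', hi', e⟩
          have := oppFace_injective' v e; subst this
          exact Finset.mem_erase.1 hi'
        · intro h; exact ⟨i, Finset.mem_erase.2 h, rfl⟩
      simp only [him, hFv, false_and, hex, false_or]
      split_ifs with h
      · constructor
        · rintro (⟨hi, hn⟩ | ⟨⟨hik, hi⟩, hn⟩)
          · by_cases hik : i = k
            · rw [hik]
            · exact absurd ⟨hik, hi⟩ hn
          · exact absurd hi hn
        · intro e
          have := oppFace_injective' v e; subst this
          exact Or.inl ⟨h, fun h' => h'.1 rfl⟩
      · constructor
        · rintro (⟨hi, hn⟩ | ⟨⟨hik, hi⟩, hn⟩)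
          · by_cases hik : i = k
            · subst hik; exact absurd hi h
            · exact absurd ⟨hik, hi⟩ hn
          · exact absurd hi hn
        · intro e; exact absurd e.symm (hvo i)
    · have hFo' : ∀ i, F ≠ oppFace v i := fun i e => hFo ⟨i, e⟩
      have hno : ¬ ∃ i ∈ S, F = oppFace v i := fun ⟨i, _, e⟩ => hFo' i e
      have hno' : ¬ ∃ i ∈ S.erase k, F = oppFace v i := fun ⟨i, _, e⟩ => hFo' i e
      simp only [hno, hno', hFv, false_and, or_false, not_false_eq_true, and_true, false_iff]
      split_ifs with h
      · exact hFo' k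
      · exact hFv

/-! ## Part A2. Boundary six-point spaces at the edges of `v`, boundary cores, and HT1∂ (core decomposition) -/

/-- membership in `T6b`, as support + parity profile `corners Δ {s}`. [cite: KhristoforovSmirnov2021, §1.2 (loop configurations, pp. 2–4)] -/
theorem mem_T6b_iff (v : HexVertex) (k : Fin 3) (s : HexVertex) (A : Finset (Sym2 (Site 2))) :
    A ∈ T6b D v k s ↔ A ⊆ (hBonds D).erase (side v k) ∧ ParityIs D A (symmDiff (corners D) {s}) := by
  unfold T6b
  rw [mem_loopSpace6b]
  unfold ParityIs side
  refine and_congr Iff.rfl (forall₂_congr fun F _ => ?_)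
  rw [xor_corner_iff_mem_symmDiff]

/-- the boundary cores avoid the sides of `v` and lie in `H_G`. [cite: KhristoforovSmirnov2021, Lemma 4 (discrete holomorphicity: the triple bijection at a vertex)] -/
theorem hb_core_sub {v : HexVertex} {S : Finset (Fin 3)} {ζ : Finset (Sym2 (Site 2))} (hq : IsCoreb D v S ζ) :
    ζ ⊆ hBonds D ∧ ∀ j : Fin 3, side v j ∉ ζ := by
  classical
  have hsub := hq.1
  unfold Eminus at hsub
  refine ⟨fun b hb => (Finset.mem_filter.1 (hsub hb)).1, fun j hj => ?_⟩
  exact (Finset.mem_filter.1 (hsub hj)).2 j rfl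

open Classical in
/-- **HT1∂, first half**: the completion of a boundary core at `k` lies in `T6b` at the `k`-th edge with odd endpoint `coreEnd`. [cite: KhristoforovSmirnov2021, Lemma 4 (discrete holomorphicity: the triple bijection at a vertex)] -/
theorem hb_compl_mem {v : HexVertex} (hv : AllSides D v) (k : Fin 3) (S : Finset (Fin 3))
    (ζ : Finset (Sym2 (Site 2))) (hq : IsCoreb D v S ζ) : coreCompl v S k ζ ∈ T6b D v k (coreEnd v S k) := by
  obtain ⟨hζh, hside⟩ := hb_core_sub hq
  have hodd := hq.2.1
  have hpar := hq.2.2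
  rw [mem_T6b_iff]
  unfold coreCompl
  refine ⟨?_, fun F hF => ?_⟩
  · intro b hb
    rw [Finset.mem_erase]
    rcases Finset.mem_union.1 hb with h | h
    · exact ⟨fun e => hside k (e ▸ h), hζh h⟩
    · obtain ⟨i, hi, rfl⟩ := Finset.mem_image.1 h
      exact ⟨fun e => (Finset.mem_erase.1 hi).1 (side_injective v e), hv i⟩
  · rw [h1_union_sides_eq_symmDiff hside, xorDeg_holds, hpar F hF, hb_odd_xiDeg_sides hv (S.erase k) hF,
      mem_symmDiff_iff_not_iff, mem_symmDiff_iff_not_iff, Finset.mem_singleton]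
    have him : F ∈ S.image (oppFace v) ↔ ∃ i ∈ S, F = oppFace v i := by
      rw [Finset.mem_image]
      constructor
      · rintro ⟨i, hi, e⟩; exact ⟨i, hi, e.symm⟩
      · rintro ⟨i, hi, e⟩; exact ⟨i, hi, e.symm⟩
    rw [him]
    exact prop_par₁ (hb_xor_key v hodd k F)

open Classical in
/-- **HT1∂, second half**: every configuration of `T6b` at the `k`-th edge has exactly one boundary-core preimage. [cite: KhristoforovSmirnov2021, Lemma 4 (discrete holomorphicity: the triple bijection at a vertex)] -/
theorem hb_exists_unique {v : HexVertex} (hv : AllSides D v) (k : Fin 3) {s : HexVertex}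
    (hs : s ∈ ({v, oppFace v k} : Finset HexVertex)) {ξ : Finset (Sym2 (Site 2))} (hξ : ξ ∈ T6b D v k s) :
    ∃! p : Finset (Fin 3) × Finset (Sym2 (Site 2)), IsCoreb D v p.1 p.2 ∧ coreEnd v p.1 k = s ∧ coreCompl v p.1 k p.2 = ξ := by
  have hξ' := hξ
  rw [mem_T6b_iff] at hξ'
  obtain ⟨hsub, hparξ⟩ := hξ'
  have hξh : ξ ⊆ hBonds D := fun b hb => Finset.mem_of_mem_erase (hsub hb)
  have hk : side v k ∉ ξ := fun h => (Finset.mem_erase.1 (hsub h)).1 rfl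
  rw [Finset.mem_insert, Finset.mem_singleton] at hs
  have hvo : ∀ i : Fin 3, v ≠ oppFace v i := h1_ne_oppFace v
  have hvc := hb_v_not_corner hv
  have hvt := hb_v_touching hv
  obtain ⟨R, hR⟩ : ∃ R : Finset (Fin 3), R = Finset.univ.filter fun i => side v i ∈ ξ := ⟨_, rfl⟩
  obtain ⟨ζ, hζ⟩ : ∃ ζ : Finset (Sym2 (Site 2)), ζ = coreOf v ξ := ⟨_, rfl⟩
  obtain ⟨S, hS⟩ : ∃ S : Finset (Fin 3), S = oddSetOf v k s ξ := ⟨_, rfl⟩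
  have hRmem : ∀ i : Fin 3, i ∈ R ↔ side v i ∈ ξ := fun i => by rw [hR, Finset.mem_filter]; simp
  have hζmem : ∀ b, b ∈ ζ ↔ b ∈ ξ ∧ ∀ j : Fin 3, b ≠ side v j := fun b => by rw [hζ]; unfold coreOf; rw [Finset.mem_filter]
  have hζside : ∀ j : Fin 3, side v j ∉ ζ := fun j h => ((hζmem _).1 h).2 j rfl
  have hζsub : ζ ⊆ ξ := fun b hb => ((hζmem b).1 hb).1
  have hdec : ξ = ζ ∪ R.image (side v) := by
    ext b
    rw [Finset.mem_union, hζmem, Finset.mem_image]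
    constructor
    · intro hb
      by_cases h : ∀ j : Fin 3, b ≠ side v j
      · exact Or.inl ⟨hb, h⟩
      · push Not at h
        obtain ⟨j, rfl⟩ := h
        exact Or.inr ⟨j, (hRmem j).2 hb, rfl⟩
    · rintro (⟨hb, -⟩ | ⟨j, hj, rfl⟩)
      · exact hb
      · exact (hRmem j).1 hj
  have hsd : ξ = symmDiff ζ (R.image (side v)) := by rw [← h1_union_sides_eq_symmDiff hζside]; exact hdec
  -- parity of `R`: odd iff `s = v`
  have hRodd : Odd R.card ↔ s = v := by
    have h := hparξ v hvt
    rw [l1_xiDeg_eq, mem_symmDiff_iff_not_iff, Finset.mem_singleton] at h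
    rw [hR, h]
    constructor
    · intro h'; by_contra hsv; exact h' ⟨fun hc => absurd hc hvc, fun e => absurd e.symm hsv⟩
    · intro e h'; exact hvc (h'.2 e.symm)
  have hSk : k ∈ S ↔ s = oppFace v k := by
    rw [hS]; unfold oddSetOf; rw [Finset.mem_filter]; simp
  have hSi : ∀ i : Fin 3, i ≠ k → (i ∈ S ↔ side v i ∈ ξ) := by
    intro i hik; rw [hS]; unfold oddSetOf; rw [Finset.mem_filter]; simp [hik]
  have hSerase : S.erase k = R := by
    ext i
    rw [Finset.mem_erase, hRmem]
    constructor
    · rintro ⟨hik, hi⟩; exact (hSi i hik).1 hi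
    · intro hi
      have hik : i ≠ k := fun e => hk (e ▸ hi)
      exact ⟨hik, (hSi i hik).2 hi⟩
  have hScard : Odd S.card := by
    by_cases hsk : s = oppFace v k
    · have hkS : k ∈ S := hSk.2 hsk
      have : S.card = R.card + 1 := by rw [← Finset.card_erase_add_one hkS, hSerase]
      rw [this, Nat.odd_add_one, hRodd]
      intro e; exact hvo k (e.symm.trans hsk)
    · have hkS : k ∉ S := fun h => hsk (hSk.1 h)
      have : S = R := by rw [← Finset.erase_eq_of_notMem hkS, hSerase]
      rw [this, hRodd]
      exact hs.resolve_right hsk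
  have hend : coreEnd v S k = s := by
    unfold coreEnd
    split_ifs with h
    · exact (hSk.1 h).symm
    · exact (hs.resolve_right fun e => h (hSk.2 e)).symm
  -- the core property
  have hcore : IsCoreb D v S ζ := by
    refine ⟨?_, hScard, fun F hF => ?_⟩
    · intro b hb
      unfold Eminus
      rw [Finset.mem_filter]
      exact ⟨hξh (hζsub hb), ((hζmem b).1 hb).2⟩
    · have hx := xorDeg_holds ξ (R.image (side v)) F
      have hζeq : ζ = symmDiff ξ (R.image (side v)) := by
        rw [hsd, symmDiff_assoc, symmDiff_self, symmDiff_bot]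
      rw [← hζeq] at hx
      rw [hx, hparξ F hF, hb_odd_xiDeg_sides hv R hF, mem_symmDiff_iff_not_iff, mem_symmDiff_iff_not_iff,
        Finset.mem_singleton, ← hSerase, ← hend]
      have him : F ∈ S.image (oppFace v) ↔ ∃ i ∈ S, F = oppFace v i := by
        rw [Finset.mem_image]
        constructor
        · rintro ⟨i, hi, e⟩; exact ⟨i, hi, e.symm⟩
        · rintro ⟨i, hi, e⟩; exact ⟨i, hi, e.symm⟩
      rw [him]
      exact prop_par₂ (hb_xor_key v hScard k F)
  have hcompl : coreCompl v S k ζ = ξ := by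
    unfold coreCompl
    rw [hSerase, ← hdec]
  refine ⟨(S, ζ), ⟨hcore, hend, hcompl⟩, ?_⟩
  rintro ⟨S', ζ'⟩ ⟨hcore', hend', hcompl'⟩
  obtain ⟨-, hside'⟩ := hb_core_sub hcore'
  have hζ' : ζ' = ζ := by
    ext b
    rw [hζmem]
    constructor
    · intro hb
      refine ⟨?_, fun j e => hside' j (e ▸ hb)⟩
      rw [← hcompl']; unfold coreCompl; exact Finset.mem_union_left _ hb
    · rintro ⟨hbξ, hbside⟩
      rw [← hcompl'] at hbξ
      unfold coreCompl at hbξ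
      rcases Finset.mem_union.1 hbξ with h | h
      · exact h
      · obtain ⟨j, -, rfl⟩ := Finset.mem_image.1 h
        exact absurd rfl (hbside j)
  have hS' : S' = S := by
    ext i
    by_cases hik : i = k
    · subst hik
      rw [hSk]
      unfold coreEnd at hend'
      split_ifs at hend' with h
      · exact ⟨fun _ => hend'.symm, fun _ => h⟩
      · exact ⟨fun h' => absurd h' h, fun e => absurd (hend'.trans e) (hvo i)⟩
    · rw [hSi i hik]
      constructor
      · intro hi
        rw [← hcompl']; unfold coreCompl
        exact Finset.mem_union_right _ (Finset.mem_image.2 ⟨i, Finset.mem_erase.2 ⟨hik, hi⟩, rfl⟩)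
      · intro hi
        rw [← hcompl'] at hi
        unfold coreCompl at hi
        rcases Finset.mem_union.1 hi with h | h
        · exact absurd h (hside' i)
        · obtain ⟨i', hi', e⟩ := Finset.mem_image.1 h
          have := side_injective v e; subst this
          exact (Finset.mem_erase.1 hi').2
  simp only [Prod.mk.injEq]
  exact ⟨hS', hζ'⟩

/-! ## Part A3. Faces HT2∂ / HT3∂ (typed), the boundary class counts, and the assembly (H∂) from the faces -/

/-- **HT2∂ (INVARIANT TRIPLES at a vertex with all sides in `H_G`)**. [cite: KhristoforovSmirnov2021, Lemma 4 (discrete holomorphicity: the triple bijection at a vertex)] -/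
def InvariantTriplesB (D : TriMarkedDomain 5) : Prop :=
  ∀ v : HexVertex, AllSides D v → ∀ (S : Finset (Fin 3)) (ζ : Finset (Sym2 (Site 2))), IsCoreb D v S ζ →
    (S.card = 1 ∨ ∃ i ∈ S, ∃ i' ∈ S, i ≠ i' ∧ XiLinked ζ (oppFace v i) (oppFace v i')) →
      ∀ (k k' : Fin 3) (r : Fin 5) (m : Bool), ComplClassb D v S k ζ r m ↔ ComplClassb D v S k' ζ r m

/-- **HT3∂ (RE-LINKING TRIPLES at a vertex with all sides in `H_G`)** (a neighbour that is a corner face is its own partner). [cite: KhristoforovSmirnov2021, Lemma 4 (discrete holomorphicity: the triple bijection at a vertex)] -/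
def ReLinkingTriplesB (D : TriMarkedDomain 5) : Prop :=
  ∀ v : HexVertex, AllSides D v → ∀ ζ : Finset (Sym2 (Site 2)), IsCoreb D v Finset.univ ζ →
    ∀ p : Fin 3 → Fin 5, (∀ k : Fin 3, XiLinked ζ (oppFace v k) (yc D (p k))) →
      ∃ c : Fin 5, ∃ rot : Fin 3,
        XiLinked ζ (yc D c) (yc D (c + 1)) ∧ p rot = c + 2 ∧ p (rot + 1) = c + 3 ∧ p (rot + 2) = c + 4 ∧
          ∀ k : Fin 3, ComplClassb D v Finset.univ k ζ (p k) (decide (p k = c + 3))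

/-! #### the transport and the structure at the `k`-th edge (from `Bdry.sixTransport_b` / `Bdry.sixStructure_gen`) -/

/-- `loopSpace6b` depends on the bond only. [cite: KhristoforovSmirnov2021, §1.2 (loop configurations, pp. 2–4)] -/
theorem loopSpace6b_swap (u w : Site 2) (s : HexVertex) : loopSpace6b D u w s = loopSpace6b D w u s := by
  unfold loopSpace6b
  rw [Sym2.eq_swap]

/-- … and so does `InClassb`. [cite: KhristoforovSmirnov2021, §1.2 (loop configurations, pp. 2–4)] -/
theorem inClassb_swap (u w : Site 2) (s : HexVertex) (j : Fin 5) (m : Bool) (ξ : Finset (Sym2 (Site 2))) :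
    InClassb D u w s j m ξ ↔ InClassb D w u s j m ξ := by
  unfold InClassb
  rw [loopSpace6b_swap]

open Classical in
/-- (H∂) bookkeeping: the filtered class sets are bond-symmetric. [cite: KhristoforovSmirnov2021, §1.2 (loop configurations, pp. 2–4)] -/
theorem filter_inClassb_swap (u w : Site 2) (s : HexVertex) (j : Fin 5) (m : Bool) :
    (loopSpace6b D u w s).filter (fun ξ => InClassb D u w s j m ξ) =
      (loopSpace6b D w u s).filter (fun ξ => InClassb D w u s j m ξ) := by
  rw [loopSpace6b_swap]
  exact Finset.filter_congr fun ξ _ => inClassb_swap u w s j m ξ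

open Classical in
/-- **N3∂ at the `k`-th edge of `v`**: the colouring count of the pattern event is the boundary class count. [cite: KhristoforovSmirnov2021, Lemma 4 (discrete holomorphicity: the triple bijection at a vertex)] -/
theorem hb_card_event_eq_Wcb {v : HexVertex} (hv : AllSides D v) (k : Fin 3) (c : Bool) (r : Fin 5) (m : Bool) :
    #(D.verts.powerset.filter fun T : Finset (Site 2) =>
        (if m then MatchB D (↑T : Set (Site 2)) r c else MatchA D (↑T : Set (Site 2)) r c) ∧
          (Joined D (↑T : Set (Site 2)) r c v ∨ Joined D (↑T : Set (Site 2)) r c (oppFace v k))) = Wcb D v k r m := by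
  unfold Wcb T6b
  rcases hb_exists_mem hv k with hg | hg
  · exact (sixTransport_b D (hexGraph_adj_oppFace v k) (faceEdge_oppFace v k) hg c r m).symm
  · have he : faceEdge v (oppFace v k) = {faceVertex v (k + 2), faceVertex v (k + 1)} := by
      rw [faceEdge_oppFace, Finset.pair_comm]
    rw [filter_inClassb_swap (faceVertex v (k + 1)), filter_inClassb_swap (faceVertex v (k + 1))]
    exact (sixTransport_b D (hexGraph_adj_oppFace v k) he hg c r m).symm

/-- **N2∂ at the `k`-th edge of `v`**: every configuration has exactly one class. [cite: KhristoforovSmirnov2021, Lemma 4 (discrete holomorphicity: the triple bijection at a vertex)] -/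
theorem hb_structure {v : HexVertex} (hv : AllSides D v) (k : Fin 3) {s : HexVertex}
    (hs : s ∈ ({v, oppFace v k} : Finset HexVertex)) {ξ : Finset (Sym2 (Site 2))} (hξ : ξ ∈ T6b D v k s) :
    ∃! p : Fin 5 × Bool, InClassb D (faceVertex v (k + 1)) (faceVertex v (k + 2)) s p.1 p.2 ξ := by
  unfold T6b at hξ
  rcases hb_exists_mem hv k with hg | hg
  · exact sixStructure_gen D (hexGraph_adj_oppFace v k) (faceEdge_oppFace v k) hg hs hξ
  · have he : faceEdge v (oppFace v k) = {faceVertex v (k + 2), faceVertex v (k + 1)} := by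
      rw [faceEdge_oppFace, Finset.pair_comm]
    rw [loopSpace6b_swap] at hξ
    have h := sixStructure_gen D (hexGraph_adj_oppFace v k) he hg hs hξ
    simpa only [inClassb_swap (faceVertex v (k + 2))] using h

/-- `2^{#G} · F_j(e_k)` in terms of the boundary class counts. [cite: KhristoforovSmirnov2021, Lemma 4 (discrete holomorphicity: the triple bijection at a vertex)] -/
theorem hb_sparseObs_eq {v : HexVertex} (hv : AllSides D v) (k : Fin 3) (c : Bool) (j : Fin 5) :
    (2 : ℂ) ^ #D.verts * sparseObs D j c v (oppFace v k) =
      (Wcb D v k j false : ℂ) - tau ^ 2 * (Wcb D v k (j + 1) true : ℂ) - tau * (Wcb D v k (j + 4) true : ℂ) := by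
  classical
  unfold sparseObs
  rw [ha_patternProb_eq_card_div, ha_patternProb_eq_card_div, ha_patternProb_eq_card_div,
    hb_card_event_eq_Wcb hv, hb_card_event_eq_Wcb hv, hb_card_event_eq_Wcb hv]
  have h2 : (2 : ℂ) ^ #D.verts ≠ 0 := pow_ne_zero _ two_ne_zero
  push_cast
  field_simp

/-- `τ² + τ + 1 = 0`. [folklore] -/
private theorem hb_tau_sum : 1 + tau + tau ^ 2 = 0 := by
  have hprim : IsPrimitiveRoot tau 3 := by
    have h := Complex.isPrimitiveRoot_exp 3 (by norm_num)
    unfold tau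
    convert h using 2
    push_cast
    ring
  have h := hprim.geom_sum_eq_zero (by norm_num : 1 < 3)
  simp only [Finset.sum_range_succ, Finset.sum_range_zero, pow_zero, pow_one, zero_add] at h
  linear_combination h

/-- `τ³ = 1`, as `τ³ − 1 = 0`. [folklore] -/
private theorem hb_tau_cube : tau ^ 3 - 1 = 0 := by linear_combination (tau - 1) * hb_tau_sum

open Classical in
/-- `2^{#G} · F_j(e_k)` as a sum of weights over the boundary spaces at the `k`-th edge. [cite: KhristoforovSmirnov2021, Lemma 4 (discrete holomorphicity: the triple bijection at a vertex)] -/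
theorem hb_sparseObs_eq_sum {v : HexVertex} (hv : AllSides D v) (k : Fin 3) (c : Bool) (j : Fin 5) :
    (2 : ℂ) ^ #D.verts * sparseObs D j c v (oppFace v k) =
      ∑ ξ ∈ T6b D v k v, Gkb D v k j v ξ + ∑ ξ ∈ T6b D v k (oppFace v k), Gkb D v k j (oppFace v k) ξ := by
  rw [hb_sparseObs_eq hv]
  unfold Wcb Gkb
  rw [← ha_weighted_counts_eq_sum, ← ha_weighted_counts_eq_sum]
  push_cast
  ring

open Classical in
/-- (H∂) bookkeeping. [cite: KhristoforovSmirnov2021, Lemma 4 (discrete holomorphicity: the triple bijection at a vertex)] -/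
theorem hb_mem_coreSetb {v : HexVertex} {q : Finset (Fin 3) × Finset (Sym2 (Site 2))} :
    q ∈ coreSetb D v ↔ IsCoreb D v q.1 q.2 := by
  unfold coreSetb
  rw [Finset.mem_filter, Finset.mem_product, Finset.mem_powerset]
  constructor
  · exact fun h => h.2
  · intro h; exact ⟨⟨Finset.mem_univ _, h.1⟩, h⟩

open Classical in
/-- **regrouping over boundary cores** (HT1∂). [cite: KhristoforovSmirnov2021, Lemma 4 (discrete holomorphicity: the triple bijection at a vertex)] -/
theorem hb_regroup {v : HexVertex} (hv : AllSides D v) (k : Fin 3) (G : HexVertex → Finset (Sym2 (Site 2)) → ℂ) :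
    ∑ ξ ∈ T6b D v k v, G v ξ + ∑ ξ ∈ T6b D v k (oppFace v k), G (oppFace v k) ξ =
      ∑ q ∈ coreSetb D v, G (coreEnd v q.1 k) (coreCompl v q.1 k q.2) := by
  have hmap : ∀ (S : Finset (Fin 3)) (ζ : Finset (Sym2 (Site 2))), IsCoreb D v S ζ → coreCompl v S k ζ ∈ T6b D v k (coreEnd v S k) :=
    fun S ζ hq => hb_compl_mem hv k S ζ hq
  have huniq : ∀ s ∈ ({v, oppFace v k} : Finset HexVertex), ∀ ξ ∈ T6b D v k s,
      ∃! p : Finset (Fin 3) × Finset (Sym2 (Site 2)), IsCoreb D v p.1 p.2 ∧ coreEnd v p.1 k = s ∧ coreCompl v p.1 k p.2 = ξ :=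
    fun s hs ξ hξ => hb_exists_unique hv k hs hξ
  have hne : v ≠ oppFace v k := (hexGraph_adj_oppFace v k).ne
  rw [← Finset.sum_filter_add_sum_filter_not (coreSetb D v) (fun q => coreEnd v q.1 k = v)]
  congr 1
  · symm
    refine Finset.sum_nbij (fun q => coreCompl v q.1 k q.2) (fun q hq => ?_) (fun q₁ hq₁ q₂ hq₂ heq => ?_) (fun ξ hξ => ?_)
      (fun q hq => ?_)
    · rw [Finset.mem_filter, hb_mem_coreSetb] at hq
      have := hmap q.1 q.2 hq.1
      rw [hq.2] at this; exact this
    · rw [Finset.mem_coe, Finset.mem_filter, hb_mem_coreSetb] at hq₁ hq₂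
      have hξ := hmap q₁.1 q₁.2 hq₁.1
      rw [hq₁.2] at hξ
      obtain ⟨p, -, hpu⟩ := huniq v (by simp) _ hξ
      have e1 := hpu q₁ ⟨hq₁.1, hq₁.2, rfl⟩
      have e2 := hpu q₂ ⟨hq₂.1, hq₂.2, heq.symm⟩
      exact e1.trans e2.symm
    · rw [Finset.mem_coe] at hξ
      obtain ⟨p, ⟨hc, hend, hcomp⟩, -⟩ := huniq v (by simp) _ hξ
      exact ⟨p, by rw [Finset.mem_coe, Finset.mem_filter, hb_mem_coreSetb]; exact ⟨hc, hend⟩, hcomp⟩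
    · rw [Finset.mem_filter] at hq
      rw [hq.2]
  · symm
    refine Finset.sum_nbij (fun q => coreCompl v q.1 k q.2) (fun q hq => ?_) (fun q₁ hq₁ q₂ hq₂ heq => ?_) (fun ξ hξ => ?_)
      (fun q hq => ?_)
    · rw [Finset.mem_filter, hb_mem_coreSetb] at hq
      have hend : coreEnd v q.1 k = oppFace v k := (ha_coreEnd_eq_or v q.1 k).resolve_left hq.2
      have := hmap q.1 q.2 hq.1
      rw [hend] at this; exact this
    · rw [Finset.mem_coe, Finset.mem_filter, hb_mem_coreSetb] at hq₁ hq₂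
      have hend₁ : coreEnd v q₁.1 k = oppFace v k := (ha_coreEnd_eq_or v q₁.1 k).resolve_left hq₁.2
      have hend₂ : coreEnd v q₂.1 k = oppFace v k := (ha_coreEnd_eq_or v q₂.1 k).resolve_left hq₂.2
      have hξ := hmap q₁.1 q₁.2 hq₁.1
      rw [hend₁] at hξ
      obtain ⟨p, -, hpu⟩ := huniq (oppFace v k) (by simp) _ hξ
      have e1 := hpu q₁ ⟨hq₁.1, hend₁, rfl⟩
      have e2 := hpu q₂ ⟨hq₂.1, hend₂, heq.symm⟩
      exact e1.trans e2.symm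
    · rw [Finset.mem_coe] at hξ
      obtain ⟨p, ⟨hc, hend, hcomp⟩, -⟩ := huniq (oppFace v k) (by simp) _ hξ
      refine ⟨p, ?_, hcomp⟩
      rw [Finset.mem_coe, Finset.mem_filter, hb_mem_coreSetb]
      exact ⟨hc, by rw [hend]; exact hne.symm⟩
    · rw [Finset.mem_filter] at hq
      rw [(ha_coreEnd_eq_or v q.1 k).resolve_left hq.2]

open Classical in
/-- uniqueness of the class of the `k`-th completion turns its weight into `φ_j` of that class. [cite: KhristoforovSmirnov2021, Lemma 4 (discrete holomorphicity: the triple bijection at a vertex)] -/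
theorem hb_Gk_eq_phiW {v : HexVertex} (hv : AllSides D v) (k : Fin 3) (j : Fin 5)
    {S : Finset (Fin 3)} {ζ : Finset (Sym2 (Site 2))} (hq : IsCoreb D v S ζ) {a : Fin 5} {b : Bool}
    (hcls : ComplClassb D v S k ζ a b) :
    Gkb D v k j (coreEnd v S k) (coreCompl v S k ζ) = phiW j a b := by
  have hξ : coreCompl v S k ζ ∈ T6b D v k (coreEnd v S k) := hb_compl_mem hv k S ζ hq
  have hs : coreEnd v S k ∈ ({v, oppFace v k} : Finset HexVertex) := by
    rcases ha_coreEnd_eq_or v S k with h | h <;> rw [h] <;> simp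
  have huniq := hb_structure hv k hs hξ
  have key : (fun r m => InClassb D (faceVertex v (k + 1)) (faceVertex v (k + 2)) (coreEnd v S k) r m (coreCompl v S k ζ)) =
      fun r m => r = a ∧ m = b := by
    funext r m
    apply propext
    constructor
    · intro h
      have e := huniq.unique (y₁ := (r, m)) (y₂ := (a, b)) h hcls
      exact ⟨congrArg Prod.fst e, congrArg Prod.snd e⟩
    · rintro ⟨rfl, rfl⟩; exact hcls
  unfold Gkb
  rw [key, ha_gphi_eq_phiW]

/-- at most two sides if one side is missing. [folklore] -/
private theorem hb_card_filter_le_two_of_not {p : Fin 3 → Prop} [DecidablePred p] {j₀ : Fin 3} (h : ¬ p j₀) :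
    #((Finset.univ : Finset (Fin 3)).filter p) ≤ 2 := by
  have hsub : (Finset.univ : Finset (Fin 3)).filter p ⊆ Finset.univ.erase j₀ := by
    intro j hj
    rw [Finset.mem_erase]
    exact ⟨fun e => h (e ▸ (Finset.mem_filter.1 hj).2), Finset.mem_univ _⟩
  exact (Finset.card_le_card hsub).trans (by rw [Finset.card_erase_of_mem (Finset.mem_univ _)]; simp)

open Classical in
/-- **degrees in a boundary core are at most two.** [cite: KhristoforovSmirnov2021, Lemma 4 (discrete holomorphicity: the triple bijection at a vertex)] -/
theorem hb_core_deg_le_two {v : HexVertex} {S : Finset (Fin 3)} {ζ : Finset (Sym2 (Site 2))} (hq : IsCoreb D v S ζ) (F : HexVertex) :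
    xiDeg ζ F ≤ 2 := by
  obtain ⟨hζh, hside⟩ := hb_core_sub hq
  have hpar := hq.2.2
  by_cases hF : F ∈ triFacesTouching D.verts
  · by_cases hodd : Odd (xiDeg ζ F)
    · have hmem := (hpar F hF).1 hodd
      rcases Finset.mem_symmDiff.1 hmem with ⟨hc, -⟩ | ⟨hx, -⟩
      · obtain ⟨i, hi⟩ := (mem_corners D).1 hc
        obtain ⟨j₀, hj₀⟩ := exists_side_not_mem_hBonds_of_corner D ((isCornerFace_iff_eq_yc D).2 hi)
        exact hb_card_filter_le_two_of_not (j₀ := j₀) fun h => hj₀ (hζh h)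
      · obtain ⟨i, -, rfl⟩ := Finset.mem_image.1 hx
        refine hb_card_filter_le_two_of_not (j₀ := oppIdx v i) fun h => ?_
        have h' : side (oppFace v i) (oppIdx v i) ∈ ζ := h
        rw [side_oppFace_oppIdx] at h'
        exact hside i h'
    · have h3 : xiDeg ζ F ≤ 3 := (Finset.card_filter_le _ _).trans (by simp)
      rcases Nat.even_or_odd (xiDeg ζ F) with ⟨k, hk⟩ | ho
      · omega
      · exact absurd ho hodd
  · have : xiDeg ζ F = 0 := by
      unfold xiDeg
      rw [Finset.card_eq_zero, Finset.filter_eq_empty_iff]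
      intro j _ hj
      exact hF (mem_touching_of_side_mem D (hζh hj))
    omega

open Classical in
/-- **corner partners** in a boundary core with all three neighbours odd-indexed and no two linked: each neighbour is linked to a
corner (a neighbour that is a corner face is its own partner). [cite: KhristoforovSmirnov2021, Lemma 4 (discrete holomorphicity: the triple bijection at a vertex)] -/
theorem hb_core_partners {v : HexVertex} (hv : AllSides D v) {ζ : Finset (Sym2 (Site 2))} (hq : IsCoreb D v Finset.univ ζ)
    (hnl : ∀ i i' : Fin 3, i ≠ i' → ¬ XiLinked ζ (oppFace v i) (oppFace v i')) (k : Fin 3) :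
    ∃ i : Fin 5, XiLinked ζ (oppFace v k) (yc D i) := by
  obtain ⟨hζh, -⟩ := hb_core_sub hq
  have hpar := hq.2.2
  by_cases hc : oppFace v k ∈ corners D
  · obtain ⟨i, hi⟩ := (mem_corners D).1 hc
    exact ⟨i, (xiLinked_iff_reachable _ _ _).2 (by rw [hi])⟩
  have hxt : oppFace v k ∈ triFacesTouching D.verts := hb_opp_touching hv k
  have hxodd : Odd (xiDeg ζ (oppFace v k)) :=
    (hpar _ hxt).2 (Finset.mem_symmDiff.2 (Or.inr ⟨Finset.mem_image.2 ⟨k, Finset.mem_univ _, rfl⟩, hc⟩))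
  obtain ⟨⟨Y, hYne, hYodd, hreach⟩, -⟩ := odd_component D hζh (hb_core_deg_le_two hq) hxt hxodd
  have hYt : Y ∈ triFacesTouching D.verts := by
    obtain ⟨w⟩ := hreach.symm
    cases w with
    | nil => exact absurd rfl hYne
    | cons hadj _ => exact sideGraph_adj_touching D hζh hadj
  have hYmem := (hpar Y hYt).1 hYodd
  rcases Finset.mem_symmDiff.1 hYmem with ⟨hcY, -⟩ | ⟨hx, -⟩
  · obtain ⟨i, rfl⟩ := (mem_corners D).1 hcY
    exact ⟨i, (xiLinked_iff_reachable _ _ _).2 hreach⟩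
  · obtain ⟨i, -, rfl⟩ := Finset.mem_image.1 hx
    have hik : k ≠ i := fun e => hYne (by rw [e])
    exact absurd ((xiLinked_iff_reachable _ _ _).2 hreach) (hnl k i hik)

open Classical in
/-- **every boundary core triple contributes zero** to `Σ_k τ^k · 2^{#G} F_j(e_k)` (given HT2∂, HT3∂). [cite: KhristoforovSmirnov2021, Lemma 4 (discrete holomorphicity: the triple bijection at a vertex)] -/
theorem hb_core_vanish (h2 : InvariantTriplesB D) (h3 : ReLinkingTriplesB D)
    {v : HexVertex} (hv : AllSides D v) (j : Fin 5) {S : Finset (Fin 3)} {ζ : Finset (Sym2 (Site 2))}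
    (hq : IsCoreb D v S ζ) :
    ∑ k : Fin 3, tau ^ (k : ℕ) * Gkb D v k j (coreEnd v S k) (coreCompl v S k ζ) = 0 := by
  by_cases hinv : S.card = 1 ∨ ∃ i ∈ S, ∃ i' ∈ S, i ≠ i' ∧ XiLinked ζ (oppFace v i) (oppFace v i')
  · have hcls := h2 v hv S ζ hq hinv
    have hG : ∀ k : Fin 3, Gkb D v k j (coreEnd v S k) (coreCompl v S k ζ) = Gkb D v 0 j (coreEnd v S 0) (coreCompl v S 0 ζ) := by
      intro k
      unfold Gkb
      have e : (fun r m => InClassb D (faceVertex v (k + 1)) (faceVertex v (k + 2)) (coreEnd v S k) r m (coreCompl v S k ζ)) =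
          fun r m => InClassb D (faceVertex v (0 + 1)) (faceVertex v (0 + 2)) (coreEnd v S 0) r m (coreCompl v S 0 ζ) := by
        funext r m; exact propext (hcls k 0 r m)
      rw [e]
    rw [Fin.sum_univ_three, hG 0, hG 1, hG 2]
    simp only [Fin.val_zero, Fin.val_one, Fin.val_two, pow_zero, pow_one, one_mul]
    linear_combination (Gkb D v 0 j (coreEnd v S 0) (coreCompl v S 0 ζ)) * hb_tau_sum
  · have hcard : ¬ S.card = 1 := fun h => hinv (Or.inl h)
    have hnolink : ∀ i ∈ S, ∀ i' ∈ S, i ≠ i' → ¬ XiLinked ζ (oppFace v i) (oppFace v i') :=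
      fun i hi i' hi' hne hl => hinv (Or.inr ⟨i, hi, i', hi', hne, hl⟩)
    have hS : S = Finset.univ := by
      have hle : S.card ≤ 3 := by simpa using Finset.card_le_univ S
      obtain ⟨m, hm⟩ := hq.2.1
      apply Finset.eq_univ_of_card
      simp only [Fintype.card_fin]
      omega
    subst hS
    have hnl : ∀ i i' : Fin 3, i ≠ i' → ¬ XiLinked ζ (oppFace v i) (oppFace v i') :=
      fun i i' hii' => hnolink i (Finset.mem_univ _) i' (Finset.mem_univ _) hii'
    choose p hp using hb_core_partners hv hq hnl
    obtain ⟨c, rot, -, hc0, hc1, hc2, hcls⟩ := h3 v hv ζ hq p hp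
    have hG : ∀ k : Fin 3, Gkb D v k j (coreEnd v Finset.univ k) (coreCompl v Finset.univ k ζ) = phiW j (p k) (decide (p k = c + 3)) :=
      fun k => hb_Gk_eq_phiW hv k j hq (hcls k)
    have := tripleAlgebra_holds c j rot p hc0 hc1 hc2
    simp only [hG]
    exact this

/-- **(H∂) at a vertex with all sides in `H_G`, from the faces HT2∂ and HT3∂** (`oppFace` indexing). [cite: KhristoforovSmirnov2021, Lemma 4 (discrete holomorphicity: the triple bijection at a vertex)] -/
theorem hb_holomorphyAt_of_faces (h2 : InvariantTriplesB D) (h3 : ReLinkingTriplesB D)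
    {v : HexVertex} (hv : AllSides D v) (c : Bool) (j : Fin 5) :
    ∑ k : Fin 3, tau ^ (k : ℕ) * sparseObs D j c v (oppFace v k) = 0 := by
  classical
  have h2G : (2 : ℂ) ^ #D.verts ≠ 0 := pow_ne_zero _ two_ne_zero
  have key : (2 : ℂ) ^ #D.verts * ∑ k : Fin 3, tau ^ (k : ℕ) * sparseObs D j c v (oppFace v k) = 0 := by
    rw [Finset.mul_sum]
    have step : ∀ k : Fin 3, (2 : ℂ) ^ #D.verts * (tau ^ (k : ℕ) * sparseObs D j c v (oppFace v k)) =
        ∑ q ∈ coreSetb D v, tau ^ (k : ℕ) * Gkb D v k j (coreEnd v q.1 k) (coreCompl v q.1 k q.2) := by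
      intro k
      rw [mul_left_comm, hb_sparseObs_eq_sum hv, hb_regroup hv k (fun s ξ => Gkb D v k j s ξ), Finset.mul_sum]
    simp only [step]
    rw [Finset.sum_comm]
    refine Finset.sum_eq_zero fun q hq => ?_
    rw [hb_mem_coreSetb] at hq
    exact hb_core_vanish h2 h3 hv j hq
  rcases mul_eq_zero.1 key with h | h
  · exact absurd h h2G
  · exact h

/-- **(H∂) in the `ccwNbr` form, from the faces.** [cite: KhristoforovSmirnov2021, Lemma 4 (discrete holomorphicity: the triple bijection at a vertex)] -/
theorem hb_holomorphy_ccw_of_faces (h2 : InvariantTriplesB D) (h3 : ReLinkingTriplesB D)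
    {v : HexVertex} (hv : AllSides D v) (c : Bool) (j : Fin 5) :
    ∑ k : Fin 3, tau ^ (k : ℕ) * sparseObs D j c v (ccwNbr v k) = 0 := by
  have hopp := hb_holomorphyAt_of_faces h2 h3 hv c j
  rw [Fin.sum_univ_three] at hopp ⊢
  simp only [ha_ccwNbr_eq_oppFace]
  by_cases hup : v.2 = 0
  · simp only [hup, ↓reduceIte, Fin.val_zero, Fin.val_one, Fin.val_two, pow_zero, pow_one, one_mul] at hopp ⊢
    have e0 : ((0 : Fin 3) + 2) = 2 := by decide
    have e1 : ((1 : Fin 3) + 2) = 0 := by decide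
    have e2 : ((2 : Fin 3) + 2) = 1 := by decide
    rw [e0, e1, e2]
    linear_combination tau * hopp - (sparseObs D j c v (oppFace v 2)) * hb_tau_cube
  · simp only [hup, ↓reduceIte, Fin.val_zero, Fin.val_one, Fin.val_two, pow_zero, pow_one, one_mul] at hopp ⊢
    exact hopp


/-! ## Part B. HT2∂ — invariant triples at a vertex with all sides in `H_G` (the tree's HT2 re-run; a corner neighbour in `S` is isolated) -/

/-- `InClassb` unfolded: membership, the link of `s` to `y_j`, the pattern. [cite: KhristoforovSmirnov2021, §1.2 (loop configurations, pp. 2–4)] -/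
theorem hb_inClassb_iff (u w : Site 2) (s : HexVertex) (j : Fin 5) (m : Bool) (A : Finset (Sym2 (Site 2))) :
    InClassb D u w s j m A ↔ A ∈ loopSpace6b D u w s ∧ (sideGraph A).Reachable s (yc D j) ∧ patm D j m A := by
  unfold InClassb patm
  constructor
  · rintro ⟨h1, ⟨Y, hY, hl⟩, ⟨Y₁, Y₂, hY₁, hY₂, hl'⟩⟩
    rw [eq_yc D hY] at hl
    rw [eq_yc D hY₁, eq_yc D hY₂] at hl'
    exact ⟨h1, (xiLinked_iff_reachable _ _ _).1 hl, hl'⟩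
  · rintro ⟨h1, hl, hl'⟩
    exact ⟨h1, ⟨yc D j, yc_spec D j, (xiLinked_iff_reachable _ _ _).2 hl⟩, ⟨yc D (j + 1), yc D (if m then j + 4 else j + 2),
      yc_spec D _, yc_spec D _, hl'⟩⟩

/-- `v` is isolated in a boundary core. [cite: KhristoforovSmirnov2021, Lemma 4 (discrete holomorphicity: the triple bijection at a vertex)] -/
theorem hb_reach_v {v : HexVertex} {S : Finset (Fin 3)} {ζ : Finset (Sym2 (Site 2))} (hq : IsCoreb D v S ζ) {F : HexVertex}
    (h : (sideGraph ζ).Reachable v F) : F = v := by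
  rw [SimpleGraph.reachable_iff_reflTransGen] at h
  induction h with
  | refl => rfl
  | tail _ hbc ih =>
    subst ih
    obtain ⟨j, -, hj⟩ := hbc
    exact absurd hj ((hb_core_sub hq).2 j)

/-- **a neighbour in `S` that is a corner face has no side in the core** (its only `H_G`-side other than `side v i` would make it odd,
but in `S` it is even). [cite: KhristoforovSmirnov2021, Lemma 4 (discrete holomorphicity: the triple bijection at a vertex)] -/
theorem hb_corner_nbr_deg_zero {v : HexVertex} (hv : AllSides D v) {S : Finset (Fin 3)} {ζ : Finset (Sym2 (Site 2))}
    (hq : IsCoreb D v S ζ) {i : Fin 3} (hi : i ∈ S) (hc : oppFace v i ∈ corners D) : xiDeg ζ (oppFace v i) = 0 := by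
  classical
  obtain ⟨hζh, hside⟩ := hb_core_sub hq
  obtain ⟨a, ha⟩ := (mem_corners D).1 hc
  obtain ⟨j₀, hj₀⟩ := exists_side_not_mem_hBonds_of_corner D ((isCornerFace_iff_eq_yc D).2 ha)
  have heven : ¬ Odd (xiDeg ζ (oppFace v i)) := by
    rw [hq.2.2 _ (hb_opp_touching hv i), Finset.mem_symmDiff]
    rintro (⟨-, h⟩ | ⟨-, h⟩)
    · exact h (Finset.mem_image.2 ⟨i, hi, rfl⟩)
    · exact h hc
  have hle : xiDeg ζ (oppFace v i) ≤ 1 := by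
    rw [l1_xiDeg_eq]
    have hsub : ((Finset.univ : Finset (Fin 3)).filter fun j => side (oppFace v i) j ∈ ζ) ⊆
        (Finset.univ.erase j₀).erase (oppIdx v i) := by
      intro j hj
      rw [Finset.mem_filter] at hj
      rw [Finset.mem_erase, Finset.mem_erase]
      refine ⟨fun e => ?_, fun e => hj₀ (e ▸ hζh hj.2), Finset.mem_univ _⟩
      rw [e, side_oppFace_oppIdx] at hj
      exact hside i hj.2
    have hne : oppIdx v i ≠ j₀ := by
      intro e
      apply hj₀
      rw [← e, side_oppFace_oppIdx]
      exact hv i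
    have hcard : #((Finset.univ.erase j₀).erase (oppIdx v i)) = 1 := by
      rw [Finset.card_erase_of_mem (Finset.mem_erase.2 ⟨hne, Finset.mem_univ _⟩),
        Finset.card_erase_of_mem (Finset.mem_univ _)]
      simp
    exact (Finset.card_le_card hsub).trans hcard.le
  rcases Nat.even_or_odd (xiDeg ζ (oppFace v i)) with ⟨m, hm⟩ | ho
  · omega
  · exact absurd ho heven

/-- … hence it is isolated in the core. [cite: KhristoforovSmirnov2021, Lemma 4 (discrete holomorphicity: the triple bijection at a vertex)] -/
theorem hb_corner_nbr_reach {v : HexVertex} (hv : AllSides D v) {S : Finset (Fin 3)} {ζ : Finset (Sym2 (Site 2))}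
    (hq : IsCoreb D v S ζ) {i : Fin 3} (hi : i ∈ S) (hc : oppFace v i ∈ corners D) {F : HexVertex}
    (h : (sideGraph ζ).Reachable (oppFace v i) F) : F = oppFace v i := by
  classical
  have h0 := hb_corner_nbr_deg_zero hv hq hi hc
  rw [l1_xiDeg_eq, Finset.card_eq_zero, Finset.filter_eq_empty_iff] at h0
  rw [SimpleGraph.reachable_iff_reflTransGen] at h
  induction h with
  | refl => rfl
  | tail _ hbc ih =>
    subst ih
    obtain ⟨j, -, hj⟩ := hbc
    exact absurd hj (h0 (Finset.mem_univ j))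

/-- an `S`-neighbour that is not a corner face is odd. [cite: KhristoforovSmirnov2021, Lemma 4 (discrete holomorphicity: the triple bijection at a vertex)] -/
theorem hb_odd_opp {v : HexVertex} (hv : AllSides D v) {S : Finset (Fin 3)} {ζ : Finset (Sym2 (Site 2))}
    (hq : IsCoreb D v S ζ) {i : Fin 3} (hi : i ∈ S) (hc : oppFace v i ∉ corners D) : Odd (xiDeg ζ (oppFace v i)) :=
  (hq.2.2 _ (hb_opp_touching hv i)).2 (Finset.mem_symmDiff.2 (Or.inr ⟨Finset.mem_image.2 ⟨i, hi, rfl⟩, hc⟩))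

/-- a corner which is not an `S`-neighbour is odd. [cite: KhristoforovSmirnov2021, Lemma 4 (discrete holomorphicity: the triple bijection at a vertex)] -/
theorem hb_odd_yc {v : HexVertex} {S : Finset (Fin 3)} {ζ : Finset (Sym2 (Site 2))} (hq : IsCoreb D v S ζ) (a : Fin 5)
    (ha : ∀ i ∈ S, oppFace v i ≠ yc D a) : Odd (xiDeg ζ (yc D a)) :=
  (hq.2.2 _ (yc_mem_touching D a)).2 (Finset.mem_symmDiff.2 (Or.inl ⟨yc_mem_corners D a, fun h => by
    obtain ⟨i, hi, e⟩ := Finset.mem_image.1 h; exact ha i hi e⟩))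

/-- **no three odd faces in a component of a boundary core.** [cite: KhristoforovSmirnov2021, Lemma 4 (discrete holomorphicity: the triple bijection at a vertex)] -/
theorem hb_no_three {v : HexVertex} {S : Finset (Fin 3)} {ζ : Finset (Sym2 (Site 2))} (hq : IsCoreb D v S ζ) {Y₁ Y₂ Y₃ : HexVertex}
    (h1 : Y₁ ∈ triFacesTouching D.verts) (o1 : Odd (xiDeg ζ Y₁)) (o2 : Odd (xiDeg ζ Y₂)) (o3 : Odd (xiDeg ζ Y₃))
    (r12 : (sideGraph ζ).Reachable Y₁ Y₂) (r13 : (sideGraph ζ).Reachable Y₁ Y₃) (n12 : Y₁ ≠ Y₂) (n13 : Y₁ ≠ Y₃) (n23 : Y₂ ≠ Y₃) :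
    False :=
  n23 ((odd_component D (hb_core_sub hq).1 (hb_core_deg_le_two hq) h1 o1).2 Y₂ Y₃ r12 r13 o2 o3 n12.symm n13.symm)

/-- **blindness**: two `S`-neighbours linked to each other in a boundary core are linked to no corner (and neither is a corner face). [cite: KhristoforovSmirnov2021, Lemma 4 (discrete holomorphicity: the triple bijection at a vertex)] -/
theorem hb_blind {v : HexVertex} (hv : AllSides D v) {S : Finset (Fin 3)} {ζ : Finset (Sym2 (Site 2))}
    (hq : IsCoreb D v S ζ) {i₀ i₁ : Fin 3} (h0 : i₀ ∈ S) (h1 : i₁ ∈ S) (hne : i₀ ≠ i₁)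
    (hl : (sideGraph ζ).Reachable (oppFace v i₀) (oppFace v i₁)) (a : Fin 5) :
    ¬ (sideGraph ζ).Reachable (oppFace v i₀) (yc D a) ∧ ¬ (sideGraph ζ).Reachable (oppFace v i₁) (yc D a) := by
  have n01 : oppFace v i₀ ≠ oppFace v i₁ := fun e => hne (oppFace_injective' v e)
  have hc0 : oppFace v i₀ ∉ corners D := fun hc => n01 (hb_corner_nbr_reach hv hq h0 hc hl).symm
  have hc1 : oppFace v i₁ ∉ corners D := fun hc => n01 (hb_corner_nbr_reach hv hq h1 hc hl.symm)
  have o0 := hb_odd_opp hv hq h0 hc0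
  have o1 := hb_odd_opp hv hq h1 hc1
  have ht := hb_opp_touching hv i₀
  by_cases hya : ∃ i ∈ S, oppFace v i = yc D a
  · obtain ⟨i₂, hi₂, he⟩ := hya
    have hc2 : oppFace v i₂ ∈ corners D := by rw [he]; exact yc_mem_corners D a
    have h20 : oppFace v i₀ ≠ oppFace v i₂ := fun e => hc0 (e ▸ hc2)
    have h21 : oppFace v i₁ ≠ oppFace v i₂ := fun e => hc1 (e ▸ hc2)
    rw [← he]
    exact ⟨fun hr => h20 (hb_corner_nbr_reach hv hq hi₂ hc2 hr.symm), fun hr => h21 (hb_corner_nbr_reach hv hq hi₂ hc2 hr.symm)⟩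
  · push Not at hya
    have oa := hb_odd_yc hq a hya
    have n0a := hya i₀ h0
    have n1a := hya i₁ h1
    exact ⟨fun hr => hb_no_three hq ht o0 o1 oa hl hr n01 n0a n1a,
      fun hr => hb_no_three hq ht o0 o1 oa hl (hl.trans hr) n01 n0a n1a⟩

/-- pigeonhole in `Fin 3`. [folklore] -/
private theorem hb_fin3_third {i₀ i₁ i i' : Fin 3} (h : i₀ ≠ i₁) (hi : i ≠ i₀) (hi1 : i ≠ i₁) (hi' : i' ≠ i₀) (hi'1 : i' ≠ i₁) :
    i = i' := by
  revert i₀ i₁ i i'; decide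

/-- pigeonhole in `Fin 3`. [folklore] -/
private theorem hb_fin3_or {i₀ i₁ i₃ k : Fin 3} (h : i₀ ≠ i₁) (h0 : i₃ ≠ i₀) (h1 : i₃ ≠ i₁) (hk : k ≠ i₃) : k = i₀ ∨ k = i₁ := by
  revert i₀ i₁ i₃ k; decide

/-- **attachment lemma** (the tree's `ht2_reach_attach` under `AllSides`). [cite: KhristoforovSmirnov2021, Lemma 4 (discrete holomorphicity: the triple bijection at a vertex)] -/
theorem hb_reach_attach {v : HexVertex} (hv : AllSides D v) {A : Finset (Sym2 (Site 2))}
    (hAv : ∀ j : Fin 3, side v j ∉ A) (T : Finset (Fin 3)) {Y : HexVertex} (hY : Y ≠ v) (F : HexVertex) :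
    (sideGraph (A ∪ T.image (side v))).Reachable Y F ↔
      (F ≠ v ∧ ((sideGraph A).Reachable Y F ∨
        ∃ i ∈ T, ∃ i' ∈ T, (sideGraph A).Reachable Y (oppFace v i) ∧ (sideGraph A).Reachable (oppFace v i') F)) ∨
      (F = v ∧ ∃ i ∈ T, (sideGraph A).Reachable Y (oppFace v i)) := by
  classical
  have hvi : ∀ i ∈ T, (sideGraph (A ∪ T.image (side v))).Adj v (oppFace v i) := fun i hi =>
    ⟨i, rfl, Finset.mem_union_right _ (Finset.mem_image.2 ⟨i, hi, rfl⟩)⟩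
  have hle : sideGraph A ≤ sideGraph (A ∪ T.image (side v)) := ht2_sideGraph_mono Finset.subset_union_left
  constructor
  · intro h
    rw [SimpleGraph.reachable_iff_reflTransGen] at h
    induction h with
    | refl => exact Or.inl ⟨hY, Or.inl SimpleGraph.Reachable.rfl⟩
    | @tail b c _ hbc ih =>
      obtain ⟨j, hc, hj⟩ := hbc
      rcases ih with ⟨hbv, hb⟩ | ⟨hbv, i, hi, hri⟩
      · rcases Finset.mem_union.1 hj with hjA | hjX
        · have hcv : c ≠ v := by
            intro hcv
            rw [hcv] at hc
            have hs : side v (oppIdx b j) = side b j := by rw [hc, side_oppFace_oppIdx]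
            exact hAv (oppIdx b j) (hs ▸ hjA)
          have hstep : (sideGraph A).Adj b c := ⟨j, hc, hjA⟩
          refine Or.inl ⟨hcv, ?_⟩
          rcases hb with hb | ⟨i, hi, i', hi', h1, h2⟩
          · exact Or.inl (hb.trans hstep.reachable)
          · exact Or.inr ⟨i, hi, i', hi', h1, h2.trans hstep.reachable⟩
        · obtain ⟨i, hiT, hside⟩ := Finset.mem_image.1 hjX
          have hbt : b ∈ triFacesTouching D.verts := mem_touching_of_side_mem D (hside ▸ hv i)
          rcases (l3_exists_side_eq_iff D (hv i) hbt).1 ⟨j, hside.symm⟩ with hb1 | hb1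
          · exact absurd hb1 hbv
          · have hjidx : j = oppIdx v i := by
              rw [hb1, ← side_oppFace_oppIdx v i] at hside
              exact (side_injective _ hside).symm
            have hcv : c = v := by rw [hc, hb1, hjidx, oppFace_oppFace]
            refine Or.inr ⟨hcv, ?_⟩
            rcases hb with hb | ⟨i₁, hi₁, i', -, h1, -⟩
            · exact ⟨i, hiT, hb1 ▸ hb⟩
            · exact ⟨i₁, hi₁, h1⟩
      · rw [hbv] at hc hj
        have hjT : j ∈ T := by
          rcases Finset.mem_union.1 hj with hjA | hjX
          · exact absurd hjA (hAv j)
          · obtain ⟨i', hi', he⟩ := Finset.mem_image.1 hjX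
            rw [← side_injective _ he]; exact hi'
        have hcv : c ≠ v := by rw [hc]; exact (hexGraph_adj_oppFace _ j).ne.symm
        exact Or.inl ⟨hcv, Or.inr ⟨i, hi, j, hjT, hri, by rw [hc]⟩⟩
  · rintro (⟨-, h | ⟨i, hi, i', hi', h1, h2⟩⟩ | ⟨hFv, i, hi, h⟩)
    · exact h.mono hle
    · have s1 : (sideGraph (A ∪ T.image (side v))).Adj (oppFace v i) v := (hvi i hi).symm
      have s2 : (sideGraph (A ∪ T.image (side v))).Adj v (oppFace v i') := hvi i' hi'
      exact (((h1.mono hle).trans s1.reachable).trans s2.reachable).trans (h2.mono hle)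
    · subst hFv
      exact (h.mono hle).trans (hvi i hi).symm.reachable

/-- **corner-to-corner links are the same in every completion as in the core** (HT2∂ hypothesis). [cite: KhristoforovSmirnov2021, Lemma 4 (discrete holomorphicity: the triple bijection at a vertex)] -/
theorem hb_corner_link_iff {v : HexVertex} (hv : AllSides D v) {S : Finset (Fin 3)} {ζ : Finset (Sym2 (Site 2))}
    (hq : IsCoreb D v S ζ) (hinv : S.card = 1 ∨ ∃ i ∈ S, ∃ i' ∈ S, i ≠ i' ∧ XiLinked ζ (oppFace v i) (oppFace v i'))
    (k : Fin 3) (a b : Fin 5) :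
    (sideGraph (coreCompl v S k ζ)).Reachable (yc D a) (yc D b) ↔ (sideGraph ζ).Reachable (yc D a) (yc D b) := by
  obtain ⟨-, hside⟩ := hb_core_sub hq
  have hav := hb_yc_ne_v hv a
  have hbv := hb_yc_ne_v hv b
  unfold coreCompl
  rw [hb_reach_attach hv hside (S.erase k) hav]
  constructor
  · rintro (⟨-, h | ⟨i, hi, i', hi', h1, h2⟩⟩ | ⟨h, -⟩)
    · exact h
    · have hii' : i = i' := by
        rcases hinv with hc | ⟨i₀, h0, i₁, h1', hne, hl⟩
        · exact Finset.card_le_one.1 hc.le i (Finset.mem_of_mem_erase hi) i' (Finset.mem_of_mem_erase hi')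
        · rw [xiLinked_iff_reachable] at hl
          have hi0 : i ≠ i₀ := fun e => (hb_blind hv hq h0 h1' hne hl a).1 (by rw [← e]; exact h1.symm)
          have hi1 : i ≠ i₁ := fun e => (hb_blind hv hq h0 h1' hne hl a).2 (by rw [← e]; exact h1.symm)
          have hi'0 : i' ≠ i₀ := fun e => (hb_blind hv hq h0 h1' hne hl b).1 (by rw [← e]; exact h2)
          have hi'1 : i' ≠ i₁ := fun e => (hb_blind hv hq h0 h1' hne hl b).2 (by rw [← e]; exact h2)
          exact hb_fin3_third hne hi0 hi1 hi'0 hi'1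
      subst hii'
      exact h1.trans h2
    · exact absurd h hbv
  · intro h
    exact Or.inl ⟨hbv, Or.inl h⟩

/-- **the odd endpoint of every completion is linked to `y_a` iff some `S`-neighbour is linked to `y_a` in the core** (HT2∂ hypothesis). [cite: KhristoforovSmirnov2021, Lemma 4 (discrete holomorphicity: the triple bijection at a vertex)] -/
theorem hb_end_link_iff {v : HexVertex} (hv : AllSides D v) {S : Finset (Fin 3)} {ζ : Finset (Sym2 (Site 2))}
    (hq : IsCoreb D v S ζ) (hinv : S.card = 1 ∨ ∃ i ∈ S, ∃ i' ∈ S, i ≠ i' ∧ XiLinked ζ (oppFace v i) (oppFace v i'))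
    (k : Fin 3) (a : Fin 5) :
    (sideGraph (coreCompl v S k ζ)).Reachable (coreEnd v S k) (yc D a) ↔
      ∃ i ∈ S, (sideGraph ζ).Reachable (oppFace v i) (yc D a) := by
  obtain ⟨-, hside⟩ := hb_core_sub hq
  have hav := hb_yc_ne_v hv a
  unfold coreCompl coreEnd
  split_ifs with hk
  · have hkv : oppFace v k ≠ v := (hexGraph_adj_oppFace v k).ne.symm
    rw [hb_reach_attach hv hside (S.erase k) hkv]
    constructor
    · rintro (⟨-, h | ⟨i, -, i', hi', -, h2⟩⟩ | ⟨h, -⟩)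
      · exact ⟨k, hk, h⟩
      · exact ⟨i', Finset.mem_of_mem_erase hi', h2⟩
      · exact absurd h hav
    · rintro ⟨i₃, hi₃, h3⟩
      by_cases e : i₃ = k
      · subst e
        exact Or.inl ⟨hav, Or.inl h3⟩
      · rcases hinv with hc | ⟨i₀, h0, i₁, h1, hne, hl⟩
        · exact absurd (Finset.card_le_one.1 hc.le i₃ hi₃ k hk) e
        · rw [xiLinked_iff_reachable] at hl
          have hb := hb_blind hv hq h0 h1 hne hl a
          have h30 : i₃ ≠ i₀ := fun e' => hb.1 (by rw [← e']; exact h3)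
          have h31 : i₃ ≠ i₁ := fun e' => hb.2 (by rw [← e']; exact h3)
          refine Or.inl ⟨hav, Or.inr ?_⟩
          rcases hb_fin3_or hne h30 h31 (fun h => e h.symm) with rfl | rfl
          · exact ⟨i₁, Finset.mem_erase.2 ⟨hne.symm, h1⟩, i₃, Finset.mem_erase.2 ⟨e, hi₃⟩, hl, h3⟩
          · exact ⟨i₀, Finset.mem_erase.2 ⟨hne, h0⟩, i₃, Finset.mem_erase.2 ⟨e, hi₃⟩, hl.symm, h3⟩
  · rw [Finset.erase_eq_self.2 hk, SimpleGraph.reachable_comm, hb_reach_attach hv hside S hav]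
    constructor
    · rintro (⟨h, -⟩ | ⟨-, i, hi, h⟩)
      · exact absurd rfl h
      · exact ⟨i, hi, h.symm⟩
    · rintro ⟨i, hi, h⟩
      exact Or.inr ⟨rfl, i, hi, h.symm⟩

/-- **the class of every completion, read in the boundary core** (HT2∂ hypothesis). [cite: KhristoforovSmirnov2021, Lemma 4 (discrete holomorphicity: the triple bijection at a vertex)] -/
theorem hb_complClassb_iff {v : HexVertex} (hv : AllSides D v) {S : Finset (Fin 3)} {ζ : Finset (Sym2 (Site 2))}
    (hq : IsCoreb D v S ζ) (hinv : S.card = 1 ∨ ∃ i ∈ S, ∃ i' ∈ S, i ≠ i' ∧ XiLinked ζ (oppFace v i) (oppFace v i'))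
    (k : Fin 3) (r : Fin 5) (m : Bool) :
    ComplClassb D v S k ζ r m ↔ (∃ i ∈ S, (sideGraph ζ).Reachable (oppFace v i) (yc D r)) ∧ patm D r m ζ := by
  have hmem : coreCompl v S k ζ ∈ loopSpace6b D (faceVertex v (k + 1)) (faceVertex v (k + 2)) (coreEnd v S k) :=
    hb_compl_mem hv k S ζ hq
  unfold ComplClassb
  rw [hb_inClassb_iff, hb_end_link_iff hv hq hinv k r]
  unfold patm
  rw [xiLinked_iff_reachable, xiLinked_iff_reachable, hb_corner_link_iff hv hq hinv k]
  exact ⟨fun h => ⟨h.2.1, h.2.2⟩, fun h => ⟨hmem, h.1, h.2⟩⟩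

variable (D) in
/-- **HT2∂ `InvariantTriplesB` holds for every five-marked domain.** [cite: KhristoforovSmirnov2021, Lemma 4 (discrete holomorphicity: the triple bijection at a vertex)] -/
theorem invariantTriplesB_holds : InvariantTriplesB D := by
  intro v hv S ζ hq hinv k k' r m
  rw [hb_complClassb_iff hv hq hinv k r m, hb_complClassb_iff hv hq hinv k' r m]


/-! ## Part C. HT3∂ — re-linking triples at a vertex with all sides in `H_G` (the tree's HT3 re-run; corner neighbours are their own partners) -/

section Core

variable {v : HexVertex} (hv : AllSides D v) {ζ : Finset (Sym2 (Site 2))} (hq : IsCoreb D v Finset.univ ζ)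
  {p : Fin 3 → Fin 5} (hp : ∀ k : Fin 3, (sideGraph ζ).Reachable (oppFace v k) (yc D (p k)))
include hv hq hp

/-- a neighbour that is a corner face is its own partner: `y_{p k} = oppFace v k`. [cite: KhristoforovSmirnov2021, Lemma 4 (discrete holomorphicity: the triple bijection at a vertex)] -/
theorem hc_yc_eq_of_corner {k : Fin 3} (hc : oppFace v k ∈ corners D) : yc D (p k) = oppFace v k :=
  hb_corner_nbr_reach hv hq (Finset.mem_univ k) hc (hp k)

omit hp in
/-- a corner linked to a non-corner neighbour is no neighbour (hence odd). [cite: KhristoforovSmirnov2021, Lemma 4 (discrete holomorphicity: the triple bijection at a vertex)] -/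
theorem hc_yc_not_img {k : Fin 3} (hc : oppFace v k ∉ corners D) {a : Fin 5} (h : (sideGraph ζ).Reachable (oppFace v k) (yc D a)) :
    ∀ i ∈ (Finset.univ : Finset (Fin 3)), oppFace v i ≠ yc D a := by
  intro i _ e
  have hci : oppFace v i ∈ corners D := by rw [e]; exact yc_mem_corners D a
  have hik : i ≠ k := fun e' => hc (e' ▸ hci)
  have h' : (sideGraph ζ).Reachable (oppFace v i) (oppFace v k) := by rw [e]; exact h.symm
  have := hb_corner_nbr_reach hv hq (Finset.mem_univ i) hci h'
  exact hik.symm (oppFace_injective' v this)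

/-- a neighbour sees only its own corner. [cite: KhristoforovSmirnov2021, Lemma 4 (discrete holomorphicity: the triple bijection at a vertex)] -/
private theorem hc_opp_corner {k : Fin 3} {a : Fin 5} (h : (sideGraph ζ).Reachable (oppFace v k) (yc D a)) : a = p k := by
  by_cases hc : oppFace v k ∈ corners D
  · have e1 := hc_yc_eq_of_corner hv hq hp hc
    have e2 := hb_corner_nbr_reach hv hq (Finset.mem_univ k) hc h
    exact yc_injective D (e2.trans e1.symm)
  · by_contra hne
    have ok := hb_odd_opp hv hq (Finset.mem_univ k) hc
    have oa := hb_odd_yc hq a (hc_yc_not_img hv hq hc h)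
    have op := hb_odd_yc hq (p k) (hc_yc_not_img hv hq hc (hp k))
    have nka : oppFace v k ≠ yc D a := fun e => hc (by rw [e]; exact yc_mem_corners D a)
    have nkp : oppFace v k ≠ yc D (p k) := fun e => hc (by rw [e]; exact yc_mem_corners D _)
    exact hb_no_three hq (hb_opp_touching hv k) ok op oa (hp k) h nkp nka (fun e => hne (yc_injective D e).symm)

/-- the partners are distinct. [cite: KhristoforovSmirnov2021, Lemma 4 (discrete holomorphicity: the triple bijection at a vertex)] -/
private theorem hc_p_injective : Function.Injective p := by
  intro k k' h
  by_contra hne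
  by_cases hc : oppFace v k ∈ corners D
  · have e1 := hc_yc_eq_of_corner hv hq hp hc
    have h2 : (sideGraph ζ).Reachable (oppFace v k) (oppFace v k') := by rw [← e1, h]; exact (hp k').symm
    exact hne (oppFace_injective' v (hb_corner_nbr_reach hv hq (Finset.mem_univ k) hc h2).symm)
  · by_cases hc' : oppFace v k' ∈ corners D
    · have e1 := hc_yc_eq_of_corner hv hq hp hc'
      have h2 : (sideGraph ζ).Reachable (oppFace v k') (oppFace v k) := by rw [← e1, ← h]; exact (hp k).symm
      exact hne (oppFace_injective' v (hb_corner_nbr_reach hv hq (Finset.mem_univ k') hc' h2))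
    · have h1 : (sideGraph ζ).Reachable (yc D (p k)) (oppFace v k) := (hp k).symm
      have h2 : (sideGraph ζ).Reachable (yc D (p k)) (oppFace v k') := by rw [h]; exact (hp k').symm
      have op := hb_odd_yc hq (p k) (hc_yc_not_img hv hq hc (hp k))
      have nkp : oppFace v k ≠ yc D (p k) := fun e => hc (by rw [e]; exact yc_mem_corners D _)
      have nk'p : oppFace v k' ≠ yc D (p k) := fun e => hc' (by rw [e]; exact yc_mem_corners D _)
      exact hb_no_three hq (yc_mem_touching D (p k)) op (hb_odd_opp hv hq (Finset.mem_univ k) hc)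
        (hb_odd_opp hv hq (Finset.mem_univ k') hc') h1 h2 nkp.symm nk'p.symm (fun e => hne (oppFace_injective' v e))

/-- a neighbour sees no other neighbour. [cite: KhristoforovSmirnov2021, Lemma 4 (discrete holomorphicity: the triple bijection at a vertex)] -/
private theorem hc_opp_opp {k k' : Fin 3} (hne : k ≠ k') : ¬ (sideGraph ζ).Reachable (oppFace v k) (oppFace v k') := by
  intro h
  by_cases hc : oppFace v k ∈ corners D
  · exact hne (oppFace_injective' v (hb_corner_nbr_reach hv hq (Finset.mem_univ k) hc h).symm)
  · by_cases hc' : oppFace v k' ∈ corners D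
    · exact hne (oppFace_injective' v (hb_corner_nbr_reach hv hq (Finset.mem_univ k') hc' h.symm))
    · have op := hb_odd_yc hq (p k) (hc_yc_not_img hv hq hc (hp k))
      have nkp : oppFace v k ≠ yc D (p k) := fun e => hc (by rw [e]; exact yc_mem_corners D _)
      have nk'p : oppFace v k' ≠ yc D (p k) := fun e => hc' (by rw [e]; exact yc_mem_corners D _)
      exact hb_no_three hq (hb_opp_touching hv k) (hb_odd_opp hv hq (Finset.mem_univ k) hc) op
        (hb_odd_opp hv hq (Finset.mem_univ k') hc') (hp k) h nkp (fun e => hne (oppFace_injective' v e)) nk'p.symm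

/-- the partner corner of a neighbour sees no other corner. [cite: KhristoforovSmirnov2021, Lemma 4 (discrete holomorphicity: the triple bijection at a vertex)] -/
theorem hc_partner_blind (k : Fin 3) {m : Fin 5} (hm : m ≠ p k) : ¬ (sideGraph ζ).Reachable (yc D (p k)) (yc D m) := by
  intro h
  exact hm (hc_opp_corner hv hq hp ((hp k).trans h))

/-- **the left-over corners pair up.** [cite: KhristoforovSmirnov2021, Lemma 4 (discrete holomorphicity: the triple bijection at a vertex)] -/
private theorem hc_free_partner {a : Fin 5} (ha : ∀ k, a ≠ p k) :
    ∃ b : Fin 5, b ≠ a ∧ (∀ k, b ≠ p k) ∧ (sideGraph ζ).Reachable (yc D a) (yc D b) := by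
  classical
  obtain ⟨hζ, -⟩ := hb_core_sub hq
  have hya : ∀ i ∈ (Finset.univ : Finset (Fin 3)), oppFace v i ≠ yc D a := by
    intro i _ e
    have hci : oppFace v i ∈ corners D := by rw [e]; exact yc_mem_corners D a
    have := hc_yc_eq_of_corner hv hq hp hci
    exact ha i (yc_injective D (e.symm.trans this.symm).symm).symm
  obtain ⟨⟨Y, hYne, hYodd, hYr⟩, -⟩ :=
    odd_component D hζ (hb_core_deg_le_two hq) (yc_mem_touching D a) (hb_odd_yc hq a hya)
  have hYt : Y ∈ triFacesTouching D.verts := touching_of_reachable D hζ (yc_mem_touching D a) hYr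
  have hYmem := (hq.2.2 Y hYt).1 hYodd
  rcases Finset.mem_symmDiff.1 hYmem with ⟨hc, hni⟩ | ⟨hx, hnc⟩
  · obtain ⟨b, rfl⟩ := (mem_corners D).1 hc
    refine ⟨b, fun e => hYne (by rw [e]), fun k e => ?_, hYr⟩
    subst e
    exact hc_partner_blind hv hq hp k (fun e => hYne (by rw [e])) hYr.symm
  · obtain ⟨i, -, rfl⟩ := Finset.mem_image.1 hx
    exact absurd (hc_opp_corner hv hq hp hYr.symm) (ha i)

end Core

section Reduced

variable {v : HexVertex} (hv : AllSides D v) {ζ : Finset (Sym2 (Site 2))} (hq : IsCoreb D v Finset.univ ζ)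
  {p : Fin 3 → Fin 5} (hp : ∀ k : Fin 3, (sideGraph ζ).Reachable (oppFace v k) (yc D (p k)))
include hv hq hp

/-- faces on the path of `oppFace v k` have no side in `L_k`. [cite: KhristoforovSmirnov2021, Lemma 4 (discrete holomorphicity: the triple bijection at a vertex)] -/
theorem hc_no_side_of_reach (k : Fin 3) {F : HexVertex} (hF : (sideGraph ζ).Reachable (oppFace v k) F) (i : Fin 3) :
    side F i ∉ ht3Lk ζ v k := by
  classical
  obtain ⟨hζ, hside⟩ := hb_core_sub hq
  obtain ⟨hz0, -, -⟩ := restrict_off_component D hζ (oppFace v k) (ht3zk ζ v k) (ht3_mem_zk ζ v k)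
  intro hmem
  unfold ht3Lk at hmem
  rcases Finset.mem_union.1 hmem with h | h
  · have h0 := hz0 F hF
    rw [l1_xiDeg_eq, Finset.card_eq_zero, Finset.filter_eq_empty_iff] at h0
    exact h0 (Finset.mem_univ i) h
  · obtain ⟨i', hi', he⟩ := Finset.mem_image.1 h
    have hFt : F ∈ triFacesTouching D.verts := mem_touching_of_side_mem D (he ▸ hv i')
    rcases (l3_exists_side_eq_iff D (hv i') hFt).1 ⟨i, he.symm⟩ with hFv | hFo
    · rw [hFv] at hF
      exact (hexGraph_adj_oppFace v k).ne (hb_reach_v hq hF.symm).symm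
    · rw [hFo] at hF
      exact hc_opp_opp hv hq hp (fun e => (Finset.mem_erase.1 hi').1 e.symm) hF

omit hv hp in
/-- `v` has no side in a boundary core. [cite: KhristoforovSmirnov2021, Lemma 4 (discrete holomorphicity: the triple bijection at a vertex)] -/
private theorem hc_xiDeg_v : xiDeg ζ v = 0 := by
  classical
  rw [l1_xiDeg_eq, Finset.card_eq_zero, Finset.filter_eq_empty_iff]
  intro j _ hj
  exact (hb_core_sub hq).2 j hj

omit hq hp in
/-- which faces other than `v` see an odd number of attached sides: exactly the attached neighbours. [cite: KhristoforovSmirnov2021, Lemma 4 (discrete holomorphicity: the triple bijection at a vertex)] -/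
theorem hb_odd_xiDeg_image_iff (T : Finset (Fin 3)) {F : HexVertex} (hF : F ∈ triFacesTouching D.verts) (hFv : F ≠ v) :
    Odd (xiDeg (T.image (side v)) F) ↔ ∃ i ∈ T, F = oppFace v i := by
  rw [hb_odd_xiDeg_sides hv T hF]
  constructor
  · rintro (⟨h, -⟩ | h)
    · exact absurd h hFv
    · exact h
  · exact fun h => Or.inr h

/-- **the reduced configuration has its four odd faces at the corners other than `y_{p k}`.** [cite: KhristoforovSmirnov2021, §1.2 (loop configurations, pp. 3–4)] -/
theorem hc_Lk_mem_loopSpace (k : Fin 3) : ht3Lk ζ v k ∈ loopSpace D (p k) := by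
  classical
  obtain ⟨hζ, hside⟩ := hb_core_sub hq
  obtain ⟨hz0, hzs, -⟩ := restrict_off_component D hζ (oppFace v k) (ht3zk ζ v k) (ht3_mem_zk ζ v k)
  have hzsub : ht3zk ζ v k ⊆ ζ := ht3_zk_subset ζ v k
  have hzside : ∀ j : Fin 3, side v j ∉ ht3zk ζ v k := fun j h => hside j (hzsub h)
  have hpar := hq.2.2
  unfold loopSpace
  rw [Finset.mem_filter, Finset.mem_powerset]
  constructor
  · intro e he
    unfold ht3Lk at he
    rcases Finset.mem_union.1 he with h | h
    · exact hζ (hzsub h)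
    · obtain ⟨i, -, rfl⟩ := Finset.mem_image.1 h
      exact hv i
  · intro F hF
    unfold ht3Lk
    rw [ht2_union_eq_symmDiff hzside, xorDeg_holds]
    have hR : (∃ j : Fin 5, j ≠ p k ∧ IsCornerFace D j F) ↔ (∃ j : Fin 5, j ≠ p k ∧ F = yc D j) := by
      simp only [isCornerFace_iff_eq_yc]
    rw [hR]
    by_cases hFv : F = v
    · rw [hFv, ht2_xiDeg_image_v]
      have hv0 : ¬ (sideGraph ζ).Reachable (oppFace v k) v := fun h =>
        (hexGraph_adj_oppFace v k).ne (hb_reach_v hq h.symm).symm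
      rw [hzs v hv0, hc_xiDeg_v hq]
      have hcard : #((Finset.univ : Finset (Fin 3)).erase k) = 2 := by
        rw [Finset.card_erase_of_mem (Finset.mem_univ k), Finset.card_univ, Fintype.card_fin]
      rw [hcard]
      constructor
      · intro h; exact absurd (iff_of_false (by decide) (by decide)) h
      · rintro ⟨j, -, hj⟩; exact absurd hj.symm (hb_yc_ne_v hv j)
    · by_cases hFr : (sideGraph ζ).Reachable (oppFace v k) F
      · rw [hz0 F hFr, hb_odd_xiDeg_image_iff hv _ hF hFv]
        have hno : ¬ ∃ i ∈ (Finset.univ : Finset (Fin 3)).erase k, F = oppFace v i := by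
          rintro ⟨i, hi, rfl⟩
          exact hc_opp_opp hv hq hp (fun e => (Finset.mem_erase.1 hi).1 e.symm) hFr
        constructor
        · intro h; exact absurd (iff_of_false (by decide) hno) h
        · rintro ⟨j, hj, rfl⟩; exact absurd (hc_opp_corner hv hq hp hFr) hj
      · rw [hzs F hFr, hpar F hF, hb_odd_xiDeg_image_iff hv _ hF hFv, mem_symmDiff_iff_not_iff]
        have hnot_pk : ∀ j : Fin 5, F = yc D j → j ≠ p k := by
          rintro j rfl e
          exact hFr (by rw [e]; exact hp k)
        by_cases hFo : ∃ i ∈ (Finset.univ : Finset (Fin 3)).erase k, F = oppFace v i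
        · obtain ⟨i, hi, rfl⟩ := hFo
          have hin : oppFace v i ∈ (Finset.univ : Finset (Fin 3)).image (oppFace v) :=
            Finset.mem_image.2 ⟨i, Finset.mem_univ _, rfl⟩
          have hyes : ∃ i' ∈ (Finset.univ : Finset (Fin 3)).erase k, oppFace v i = oppFace v i' := ⟨i, hi, rfl⟩
          constructor
          · intro h
            have hC : oppFace v i ∈ corners D := by
              by_contra hnc
              exact h (iff_of_true (fun hci => hnc (hci.2 hin)) hyes)
            obtain ⟨j, hj⟩ := (mem_corners D).1 hC
            exact ⟨j, hnot_pk j hj, hj⟩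
          · rintro ⟨j, -, e⟩ h'
            have hC : oppFace v i ∈ corners D := by rw [e]; exact yc_mem_corners D j
            exact (h'.2 hyes) (iff_of_true hC hin)
        · have hnI : F ∉ (Finset.univ : Finset (Fin 3)).image (oppFace v) := by
            intro h
            obtain ⟨i, -, e⟩ := Finset.mem_image.1 h
            by_cases hik : i = k
            · apply hFr; rw [← e, hik]
            · exact hFo ⟨i, Finset.mem_erase.2 ⟨hik, Finset.mem_univ _⟩, e.symm⟩
          rw [ht2_not_iff_of_not hFo]
          constructor
          · intro h
            have hC : F ∈ corners D := by
              by_contra hnc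
              exact h (iff_of_false hnc hnI)
            obtain ⟨j, hj⟩ := (mem_corners D).1 hC
            exact ⟨j, hnot_pk j hj, hj⟩
          · rintro ⟨j, -, rfl⟩ h'
            exact hnI (h'.1 (yc_mem_corners D j))

/-- `L_k ⊆ hBonds`. [cite: KhristoforovSmirnov2021, §1.2 (loop configurations, pp. 3–4)] -/
theorem hc_Lk_subset (k : Fin 3) : ht3Lk ζ v k ⊆ hBonds D := by
  classical
  have h := hc_Lk_mem_loopSpace hv hq hp k
  unfold loopSpace at h
  exact Finset.mem_powerset.1 (Finset.mem_filter.1 h).1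

/-- **the reduced configuration is the loop configuration of a colouring.** [cite: KhristoforovSmirnov2021, p. 4 (the colouring ↔ loop-configuration bijection)] -/
theorem hc_exists_sigma (k : Fin 3) : ∃ σ : SiteConfig (Site 2), xiOf D σ (p k) false = ht3Lk ζ v k :=
  loopSurj_holds D (p k) false _ (hc_Lk_mem_loopSpace hv hq hp k)

/-- degrees in the reduced configuration are at most two. [cite: KhristoforovSmirnov2021, §1.2 (loop configurations, pp. 3–4)] -/
theorem hc_Lk_deg (k : Fin 3) (F : HexVertex) : xiDeg (ht3Lk ζ v k) F ≤ 2 := by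
  obtain ⟨σ, hσ⟩ := hc_exists_sigma hv hq hp k
  rw [← hσ, xiDeg_xiOf]
  exact loopDegLeTwo_holds D σ (p k) false F

/-- the corners other than `y_{p k}` are odd in `L_k`. [cite: KhristoforovSmirnov2021, §1.2 (loop configurations, pp. 3–4)] -/
theorem hc_Lk_odd_yc (k : Fin 3) {j : Fin 5} (hj : j ≠ p k) : Odd (xiDeg (ht3Lk ζ v k) (yc D j)) := by
  classical
  have h := hc_Lk_mem_loopSpace hv hq hp k
  unfold loopSpace at h
  exact ((Finset.mem_filter.1 h).2 (yc D j) (yc_mem_touching D j)).2 ⟨j, hj, yc_spec D j⟩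

/-- **no three corners in one component of `L_k`.** [cite: KhristoforovSmirnov2021, §1.2 (loop configurations, pp. 3–4)] -/
theorem hc_Lk_no_three (k : Fin 3) {x y z : Fin 5} (hx : x ≠ p k) (hy : y ≠ p k) (hz : z ≠ p k) (hxy : x ≠ y)
    (hxz : x ≠ z) (hyz : y ≠ z) (rxy : (sideGraph (ht3Lk ζ v k)).Reachable (yc D x) (yc D y))
    (rxz : (sideGraph (ht3Lk ζ v k)).Reachable (yc D x) (yc D z)) : False :=
  hyz (yc_injective D ((odd_component D (hc_Lk_subset hv hq hp k) (hc_Lk_deg hv hq hp k) (yc_mem_touching D x)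
    (hc_Lk_odd_yc hv hq hp k hx)).2 (yc D y) (yc D z) rxy rxz (hc_Lk_odd_yc hv hq hp k hy) (hc_Lk_odd_yc hv hq hp k hz)
    (fun e => hxy (yc_injective D e).symm) (fun e => hxz (yc_injective D e).symm)))

omit hv hp in
/-- links of the core off the deleted path survive in `L_k`. [cite: KhristoforovSmirnov2021, §1.2 (loop configurations, pp. 3–4)] -/
theorem hc_Lk_reach_of_reach (k : Fin 3) {Y Y' : HexVertex} (hY : ¬ (sideGraph ζ).Reachable (oppFace v k) Y)
    (h : (sideGraph ζ).Reachable Y Y') : (sideGraph (ht3Lk ζ v k)).Reachable Y Y' := by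
  obtain ⟨hζ, -⟩ := hb_core_sub hq
  obtain ⟨-, -, hzl⟩ := restrict_off_component D hζ (oppFace v k) (ht3zk ζ v k) (ht3_mem_zk ζ v k)
  have h' : (sideGraph (ht3zk ζ v k)).Reachable Y Y' := by
    rw [← xiLinked_iff_reachable] at h ⊢
    exact (hzl Y Y' hY).1 h
  exact h'.mono (ht2_sideGraph_mono (by unfold ht3Lk; exact Finset.subset_union_left))

omit hv hq hp in
/-- `k`, `k + 1`, `k + 2` are distinct. [folklore] -/
private theorem hc_fin3_ne (k : Fin 3) : k + 1 ≠ k ∧ k + 2 ≠ k ∧ k + 1 ≠ k + 2 := by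
  revert k; decide

omit hv hq hp in
/-- the three elements of `Fin 3` from any start. [folklore] -/
private theorem hc_fin3_cases (k j : Fin 3) : j = k ∨ j = k + 1 ∨ j = k + 2 := by
  revert k j; decide

omit hv hq hp in
/-- small `Fin 5` facts about a reference corner. [folklore] -/
private theorem hc_fin5_facts (r : Fin 5) : r + 1 ≠ r ∧ r + 2 ≠ r ∧ r + 4 ≠ r ∧ r + 2 ≠ r + 1 ∧ r + 4 ≠ r + 1 := by
  revert r; decide

set_option maxRecDepth 4000 in
omit hv hq hp in
/-- five distinct values exhaust `Fin 5`. [folklore] -/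
private theorem hc_fl_cover (p₀ p₁ p₂ a b : Fin 5) (hab : a ≠ b) (ha0 : a ≠ p₀) (ha1 : a ≠ p₁) (ha2 : a ≠ p₂)
    (hb0 : b ≠ p₀) (hb1 : b ≠ p₁) (hb2 : b ≠ p₂) (h01 : p₀ ≠ p₁) (h02 : p₀ ≠ p₂) (h12 : p₁ ≠ p₂)
    (x : Fin 5) : x = a ∨ x = b ∨ x = p₀ ∨ x = p₁ ∨ x = p₂ := by
  revert p₀ p₁ p₂ a b x; decide

/-- the two other neighbours' corners are linked through `v` in `L_k`. [cite: KhristoforovSmirnov2021, Lemma 4 (discrete holomorphicity: the triple bijection at a vertex)] -/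
theorem hc_Lk_reach_pp (k : Fin 3) : (sideGraph (ht3Lk ζ v k)).Reachable (yc D (p (k + 1))) (yc D (p (k + 2))) := by
  classical
  obtain ⟨hζ, hside⟩ := hb_core_sub hq
  obtain ⟨-, -, hzl⟩ := restrict_off_component D hζ (oppFace v k) (ht3zk ζ v k) (ht3_mem_zk ζ v k)
  have hzside : ∀ j : Fin 3, side v j ∉ ht3zk ζ v k := fun j h => hside j (ht3_zk_subset ζ v k h)
  obtain ⟨hk1, hk2, hk12⟩ := hc_fin3_ne k
  have h1 : (sideGraph (ht3zk ζ v k)).Reachable (yc D (p (k + 1))) (oppFace v (k + 1)) := by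
    have hnr : ¬ (sideGraph ζ).Reachable (oppFace v k) (yc D (p (k + 1))) := fun h =>
      hk1 (hc_p_injective hv hq hp (hc_opp_corner hv hq hp h))
    rw [← xiLinked_iff_reachable]
    exact (hzl _ _ hnr).1 ((xiLinked_iff_reachable _ _ _).2 (hp (k + 1)).symm)
  have h2 : (sideGraph (ht3zk ζ v k)).Reachable (oppFace v (k + 2)) (yc D (p (k + 2))) := by
    have hnr : ¬ (sideGraph ζ).Reachable (oppFace v k) (oppFace v (k + 2)) := hc_opp_opp hv hq hp hk2.symm
    rw [← xiLinked_iff_reachable]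
    exact (hzl _ _ hnr).1 ((xiLinked_iff_reachable _ _ _).2 (hp (k + 2)))
  unfold ht3Lk
  exact (hb_reach_attach hv hzside (Finset.univ.erase k) (hb_yc_ne_v hv (p (k + 1))) (yc D (p (k + 2)))).2
    (Or.inl ⟨hb_yc_ne_v hv (p (k + 2)), Or.inr ⟨k + 1, Finset.mem_erase.2 ⟨hk1, Finset.mem_univ _⟩, k + 2,
      Finset.mem_erase.2 ⟨hk2, Finset.mem_univ _⟩, h1, h2⟩⟩)

/-- the corners other than `y_{p k}` are `a`, `b`, `p (k+1)`, `p (k+2)`. [cite: KhristoforovSmirnov2021, Lemma 4 (discrete holomorphicity: the triple bijection at a vertex)] -/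
private theorem hc_cover_k (k : Fin 3) {a b : Fin 5} (hab : a ≠ b) (ha : ∀ k', a ≠ p k') (hb : ∀ k', b ≠ p k') (x : Fin 5)
    (hx : x ≠ p k) : x = a ∨ x = b ∨ x = p (k + 1) ∨ x = p (k + 2) := by
  have hinj := hc_p_injective hv hq hp
  have h01 : p 0 ≠ p 1 := fun e => absurd (hinj e) (by decide)
  have h02 : p 0 ≠ p 2 := fun e => absurd (hinj e) (by decide)
  have h12 : p 1 ≠ p 2 := fun e => absurd (hinj e) (by decide)
  have key : ∀ j : Fin 3, x = p j → x = a ∨ x = b ∨ x = p (k + 1) ∨ x = p (k + 2) := by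
    intro j hj
    rcases hc_fin3_cases k j with e | e | e
    · exact absurd (hj.trans (by rw [e])) hx
    · exact Or.inr (Or.inr (Or.inl (by rw [hj, e])))
    · exact Or.inr (Or.inr (Or.inr (by rw [hj, e])))
  rcases hc_fl_cover (p 0) (p 1) (p 2) a b hab (ha 0) (ha 1) (ha 2) (hb 0) (hb 1) (hb 2) h01 h02 h12 x with
    e | e | e | e | e
  · exact Or.inl e
  · exact Or.inr (Or.inl e)
  · exact key 0 e
  · exact key 1 e
  · exact key 2 e

/-- **NON-CROSSING at reference `p k`** (the loop lemma read in `σ_k`). [cite: KhristoforovSmirnov2021, §1.2 Lemma 2] -/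
theorem hc_nc (k : Fin 3) {a b : Fin 5} (hab : a ≠ b) (ha : ∀ k', a ≠ p k') (hb : ∀ k', b ≠ p k')
    (rab : (sideGraph ζ).Reachable (yc D a) (yc D b)) : Ht3NC a b (p k) (p (k + 1)) (p (k + 2)) := by
  obtain ⟨σ, hσ⟩ := hc_exists_sigma hv hq hp k
  obtain ⟨hk1, hk2, hk12⟩ := hc_fin3_ne k
  obtain ⟨f1, f2, f4, f21, f41⟩ := hc_fin5_facts (p k)
  have hinj := hc_p_injective hv hq hp
  have hp1 : p (k + 1) ≠ p k := fun e => hk1 (hinj e)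
  have hp2 : p (k + 2) ≠ p k := fun e => hk2 (hinj e)
  have hp12 : p (k + 1) ≠ p (k + 2) := fun e => hk12 (hinj e)
  have link_ab : (sideGraph (ht3Lk ζ v k)).Reachable (yc D a) (yc D b) :=
    hc_Lk_reach_of_reach hq k (fun h => ha k (hc_opp_corner hv hq hp h)) rab
  have link_pp := hc_Lk_reach_pp hv hq hp k
  have key : ∀ y : Fin 5, y ≠ p k → y ≠ p k + 1 → (sideGraph (ht3Lk ζ v k)).Reachable (yc D (p k + 1)) (yc D y) →
      Ht3LP a b (p (k + 1)) (p (k + 2)) (p k + 1) y := by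
    intro y hy hy1 hr
    rcases hc_cover_k hv hq hp k hab ha hb (p k + 1) f1 with e | e | e | e
    · by_cases hyb : y = b
      · exact Or.inl ⟨e, hyb⟩
      · exfalso
        rw [e] at hr hy1
        exact hc_Lk_no_three hv hq hp k (ha k) (hb k) hy hab (Ne.symm hy1) (Ne.symm hyb) link_ab hr
    · by_cases hya : y = a
      · exact Or.inr (Or.inl ⟨e, hya⟩)
      · exfalso
        rw [e] at hr hy1
        exact hc_Lk_no_three hv hq hp k (hb k) (ha k) hy hab.symm (Ne.symm hy1) (Ne.symm hya) link_ab.symm hr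
    · by_cases hy2 : y = p (k + 2)
      · exact Or.inr (Or.inr (Or.inl ⟨e, hy2⟩))
      · exfalso
        rw [e] at hr hy1
        exact hc_Lk_no_three hv hq hp k hp1 hp2 hy hp12 (Ne.symm hy1) (Ne.symm hy2) link_pp hr
    · by_cases hy2 : y = p (k + 1)
      · exact Or.inr (Or.inr (Or.inr ⟨e, hy2⟩))
      · exfalso
        rw [e] at hr hy1
        exact hc_Lk_no_three hv hq hp k hp2 hp1 hy hp12.symm (Ne.symm hy1) (Ne.symm hy2) link_pp.symm hr
  have reach_of_chain : ∀ {i i' : Fin 5} {Y Y' : HexVertex}, IsCornerFace D i Y → IsCornerFace D i' Y' →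
      Relation.ReflTransGen (IStep D σ (p k) false) Y Y' → (sideGraph (ht3Lk ζ v k)).Reachable (yc D i) (yc D i') := by
    intro i i' Y Y' hY hY' hc
    rw [eq_yc D hY, eq_yc D hY'] at hc
    rw [← xiLinked_iff_reachable, ← hσ, xiLinked_xiOf_iff]
    exact hc
  rcases (fiveMarkedLoopLemma_holds D σ (p k)).1 with ⟨⟨Y1, Y2, hY1, hY2, hc⟩, -⟩ | ⟨⟨Y1, Y4, hY1, hY4, hc⟩, -⟩
  · exact Or.inl (key (p k + 2) f2 f21 (reach_of_chain hY1 hY2 hc))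
  · exact Or.inr (key (p k + 4) f4 f41 (reach_of_chain hY1 hY4 hc))

omit hq hp in
/-- an `L_k`-step between faces other than `v` is a step of the core. [cite: KhristoforovSmirnov2021, Lemma 4 (discrete holomorphicity: the triple bijection at a vertex)] -/
theorem hc_core_adj_of_Lk_adj (k : Fin 3) {F F' : HexVertex} (h : (sideGraph (ht3Lk ζ v k)).Adj F F') (hF : F ≠ v) (hF' : F' ≠ v) :
    (sideGraph ζ).Adj F F' := by
  classical
  obtain ⟨j, hFj, hmem⟩ := h
  unfold ht3Lk at hmem
  rcases Finset.mem_union.1 hmem with hz | hx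
  · exact ⟨j, hFj, ht3_zk_subset ζ v k hz⟩
  · exfalso
    obtain ⟨i, -, he⟩ := Finset.mem_image.1 hx
    have hFt : F ∈ triFacesTouching D.verts := mem_touching_of_side_mem D (he ▸ hv i)
    rcases (l3_exists_side_eq_iff D (hv i) hFt).1 ⟨j, he.symm⟩ with h1 | h1
    · exact hF h1
    · apply hF'
      have hjidx : j = oppIdx v i := by
        rw [h1, ← side_oppFace_oppIdx v i] at he
        exact (side_injective _ he).symm
      rw [hFj, h1, hjidx, oppFace_oppFace]



/-! #### HT3∂-3. Chirality: the deleted path is white in `σ_k`; the colours around `v` (as seen inside `v`); the entry side -/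

omit hv hq hp in
/-- the outer colours under reference `r`, colour `false`. [folklore] -/
private theorem hc_arcColour_false_table (r : Fin 5) :
    arcColour r false (r + 1) = true ∧ arcColour r false (r + 2) = false ∧ arcColour r false (r + 3) = true ∧
      arcColour r false (r + 4) = false ∧ arcColour r false r = false := by
  revert r; decide

/-- **the path of `oppFace v k` is WHITE in `σ_k`**: every vertex in `G` of a face on it is closed (the tree's `ht3_white`, verbatim
under `AllSides`). [cite: BollobasRiordan2006, Ch. 7 Lemma 5 pp. 169–171] -/
theorem hc_white (k : Fin 3) {σ : SiteConfig (Site 2)} (hσ : xiOf D σ (p k) false = ht3Lk ζ v k) {F : HexVertex}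
    (hF : (sideGraph ζ).Reachable (oppFace v k) F) {w : Fin 3} (hw : faceVertex F w ∈ D.verts) : faceVertex F w ∉ σ := by
  classical
  obtain ⟨hζ, -⟩ := hb_core_sub hq
  have hFy : (sideGraph ζ).Reachable F (yc D (p k)) := hF.symm.trans (hp k)
  rw [SimpleGraph.reachable_iff_reflTransGen] at hFy
  have mono : ∀ {a : HexVertex}, (sideGraph ζ).Reachable (oppFace v k) a → ∀ {i i' : Fin 3}, i ≠ i' →
      faceVertex a i ∈ D.verts → faceVertex a i ∉ σ → faceVertex a i' ∈ D.verts → faceVertex a i' ∉ σ := by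
    intro a ha i i' hii' hi hiσ hi'
    obtain ⟨j, hj⟩ := ht3_pair_eq_side a hii'
    have hnot : s(faceVertex a i, faceVertex a i') ∉ xiOf D σ (p k) false := by
      rw [hσ, hj]; exact hc_no_side_of_reach hv hq hp k ha j
    have hadj : triGraph.Adj (faceVertex a i) (faceVertex a i') :=
      adj_of_mem_hexFaceVertices (faceVertex_mem a i) (faceVertex_mem a i') (fun e => hii' (faceVertex_injective a e))
    rw [mem_xiOf_iff' D σ (p k) false hadj (Or.inl hi), bicol_iff_of_mem_mem D σ (p k) false hi hi'] at hnot
    intro hin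
    exact hnot (iff_of_false hiσ (fun h' => h' hin))
  have key : ∀ a : HexVertex, Relation.ReflTransGen (sideGraph ζ).Adj a (yc D (p k)) →
      (sideGraph ζ).Reachable (oppFace v k) a → ∀ w : Fin 3, faceVertex a w ∈ D.verts → faceVertex a w ∉ σ := by
    intro a hab
    induction hab using Relation.ReflTransGen.head_induction_on with
    | refl =>
      intro hra w hw
      obtain ⟨w₀, h0, h1, h2, hor⟩ := isCornerFace_typeII D (yc_spec D (p k))
      have hww : w = w₀ := by
        rcases hc_fin3_cases w₀ w with e | e | e
        · exact e
        · exact absurd (e ▸ hw) h1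
        · exact absurd (e ▸ hw) h2
      subst hww
      have e1 : w + 2 + 1 = w := fin3_add_two_add_one w
      have e2 : w + 2 + 2 = w + 1 := fin3_add_two_add_two w
      have hside : s(faceVertex (yc D (p k)) w, faceVertex (yc D (p k)) (w + 1)) ∉ xiOf D σ (p k) false := by
        have := hc_no_side_of_reach hv hq hp k hra (w + 2)
        unfold side at this
        rwa [e1, e2, ← hσ] at this
      have hadj : triGraph.Adj (faceVertex (yc D (p k)) w) (faceVertex (yc D (p k)) (w + 1)) := adj_faceVertex_succ _ w
      rw [mem_xiOf_iff' D σ (p k) false hadj (Or.inl hw), bicol_iff_of_mem_not_mem D σ (p k) false hw h1] at hside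
      have harc : arcColour (p k) false (stretchIdx D (faceVertex (yc D (p k)) w, faceVertex (yc D (p k)) (w + 1))) = false := by
        obtain ⟨-, -, -, c4, c0⟩ := hc_arcColour_false_table (p k)
        rcases hor with ⟨hp1, -⟩ | ⟨hm1, -⟩
        · have hd : (faceVertex (yc D (p k)) w, faceVertex (yc D (p k)) (w + 1)) = predDart D (p k) :=
            Prod.ext (by rw [predDart_fst]; exact h0) hp1
          have e5 : p k - 1 = p k + 4 := by
            have : ∀ r : Fin 5, r - 1 = r + 4 := by decide
            exact this _
          rw [hd, stretchIdx_predDart, e5, c4]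
        · have hd : (faceVertex (yc D (p k)) w, faceVertex (yc D (p k)) (w + 1)) = D.markDart (p k) := Prod.ext h0 hm1
          rw [hd, stretchIdx_markDart, c0]
      rw [harc] at hside
      exact fun hin => hside (iff_of_true hin rfl)
    | head hac hcb ih =>
      rename_i a c
      intro hra w hw
      have hrc : (sideGraph ζ).Reachable (oppFace v k) c := hra.trans hac.reachable
      obtain ⟨j, hcj, hmem⟩ := hac
      obtain ⟨x, y, hexy, hxG, -⟩ := exists_rep_of_mem_hBonds D (hζ hmem)
      have hx : x = faceVertex a (j + 1) ∨ x = faceVertex a (j + 2) := by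
        unfold side at hexy
        rcases Sym2.eq_iff.1 hexy with ⟨h1, -⟩ | ⟨-, h2⟩
        · exact Or.inl h1.symm
        · exact Or.inr h2.symm
      obtain ⟨i₁, hi₁⟩ : ∃ i₁ : Fin 3, x = faceVertex a i₁ := by
        rcases hx with h | h
        · exact ⟨j + 1, h⟩
        · exact ⟨j + 2, h⟩
      have hxσ : x ∉ σ := by
        rcases hx with h | h
        · have hc' : x = faceVertex c (oppIdx a j + 2) := by rw [hcj, faceVertex_oppFace_succ_succ]; exact h
          have := ih hrc (oppIdx a j + 2) (hc' ▸ hxG)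
          rwa [← hc'] at this
        · have hc' : x = faceVertex c (oppIdx a j + 1) := by rw [hcj, faceVertex_oppFace_succ]; exact h
          have := ih hrc (oppIdx a j + 1) (hc' ▸ hxG)
          rwa [← hc'] at this
      by_cases hwi : w = i₁
      · rw [hwi, ← hi₁]; exact hxσ
      · exact mono hra (Ne.symm hwi) (hi₁ ▸ hxG) (hi₁ ▸ hxσ) hw
  exact key F hFy hF w hw

omit hv hq hp in
open Classical in
/-- the colour of a closed inside vertex is white. [folklore] -/
private theorem hc_vcol5_false_of_mem (σ : SiteConfig (Site 2)) (r : Fin 5) (c : Bool) {F : HexVertex} {w : Fin 3}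
    (h : faceVertex F w ∈ D.verts) (hw : faceVertex F w ∉ σ) : vcol5 D σ r c F w = false := by
  unfold vcol5; rw [if_pos h]; exact decide_eq_false hw

/-- **the colours around `v` in `σ_k`, seen inside `v`**: the two cells of the side towards `oppFace v k` are white, the cell at
`faceVertex v k` is black (for a cell outside `G` this is its outer colour under reference `p k`). [cite: BollobasRiordan2006, Ch. 7 Lemma 5 pp. 169–171] -/
theorem hc_colours_at_v (k : Fin 3) {σ : SiteConfig (Site 2)} (hσ : xiOf D σ (p k) false = ht3Lk ζ v k) :
    vcol5 D σ (p k) false v k = true ∧ vcol5 D σ (p k) false v (k + 1) = false ∧ vcol5 D σ (p k) false v (k + 2) = false := by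
  classical
  obtain ⟨hk1, -, -⟩ := hc_fin3_ne k
  have hr : (sideGraph ζ).Reachable (oppFace v k) (oppFace v k) := SimpleGraph.Reachable.refl _
  -- the side towards `oppFace v k` is not bicoloured
  have hsk : side v k ∉ ht3Lk ζ v k := by
    have := hc_no_side_of_reach hv hq hp k hr (oppIdx v k)
    rwa [side_oppFace_oppIdx] at this
  have hnb : ¬ Bicol D σ (p k) false (faceVertex v (k + 1)) (faceVertex v (k + 2)) := fun hb =>
    hsk (by rw [← hσ]; exact (mem_xiOf_iff D σ (p k) false v k).2 hb)
  have hG : HasG5 D v k := hb_exists_mem hv k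
  have heq : vcol5 D σ (p k) false v (k + 1) = vcol5 D σ (p k) false v (k + 2) := by
    by_contra hne; exact hnb ((bicol_side_iff D σ (p k) false hG).2 hne)
  -- one of the two cells is in `G`, hence white
  have c12 : vcol5 D σ (p k) false v (k + 1) = false ∧ vcol5 D σ (p k) false v (k + 2) = false := by
    rcases hb_exists_mem hv k with h1 | h2
    · have hmem : faceVertex (oppFace v k) (oppIdx v k + 2) ∈ D.verts := by rw [faceVertex_oppFace_succ_succ]; exact h1
      have hw := hc_white hv hq hp k hσ hr hmem
      rw [faceVertex_oppFace_succ_succ] at hw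
      have c1 : vcol5 D σ (p k) false v (k + 1) = false := hc_vcol5_false_of_mem σ (p k) false h1 hw
      exact ⟨c1, heq ▸ c1⟩
    · have hmem : faceVertex (oppFace v k) (oppIdx v k + 1) ∈ D.verts := by rw [faceVertex_oppFace_succ]; exact h2
      have hw := hc_white hv hq hp k hσ hr hmem
      rw [faceVertex_oppFace_succ] at hw
      have c2 : vcol5 D σ (p k) false v (k + 2) = false := hc_vcol5_false_of_mem σ (p k) false h2 hw
      exact ⟨heq.trans c2, c2⟩
  refine ⟨?_, c12.1, c12.2⟩
  -- the attached side `side v (k+1) = {x_{k+2}, x_k}` is bicoloured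
  have hmem : side v (k + 1) ∈ xiOf D σ (p k) false := by
    rw [hσ]; unfold ht3Lk
    exact Finset.mem_union_right _ (Finset.mem_image.2 ⟨k + 1, Finset.mem_erase.2 ⟨hk1, Finset.mem_univ _⟩, rfl⟩)
  have e1 : k + 1 + 1 = k + 2 := fin3_add_one_add_one k
  have e2 : k + 1 + 2 = k := fin3_add_one_add_two k
  have hb := (mem_xiOf_iff D σ (p k) false v (k + 1)).1 hmem
  have hG' : HasG5 D v (k + 1) := hb_exists_mem hv (k + 1)
  have hne := (bicol_side_iff D σ (p k) false hG').1 hb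
  rw [e1, e2, c12.2] at hne
  cases h : vcol5 D σ (p k) false v k
  · exact absurd h.symm hne
  · rfl

omit hq hp in
/-- the entry side of `v` in the 4-marked colouring of `D.forget (p k)`, given the colours at `v`: the side towards
`oppFace v (k+1)`. [cite: BollobasRiordan2006, Ch. 7 Lemma 5 p. 170 (oriented interface)] -/
theorem hc_entry_idx (k : Fin 3) {σ : SiteConfig (Site 2)} (c1 : vcol5 D σ (p k) false v (k + 1) = false)
    (c2 : vcol5 D σ (p k) false v (k + 2) = false) {j' : Fin 3} (hE : (D.forget (p k)).IsEntry σ v j') : j' = k + 1 := by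
  classical
  rw [(D.forget (p k)).isEntry_iff] at hE
  obtain ⟨-, -, ht⟩ := hE
  have htouch : faceVertex v (j' + 2) ∈ D.verts ∨ faceVertex v (j' + 2 + 1) ∈ D.verts ∨ faceVertex v (j' + 2 + 2) ∈ D.verts :=
    Or.inr (hb_exists_mem hv (j' + 2))
  rw [vcol_forget D σ (p k) htouch] at ht
  rcases hc_fin3_cases k j' with e | e | e
  · rw [e] at ht; rw [c2] at ht; exact absurd ht Bool.false_ne_true
  · exact e
  · rw [e, fin3_add_two_add_two] at ht; rw [c1] at ht; exact absurd ht Bool.false_ne_true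

omit hv hq hp in
/-- (H∂) bookkeeping. [folklore] -/
private theorem hc_bcolOf_cases {i : Fin 4} (h1 : TriMarkedDomain.bcolOf (i - 1) = true) (h2 : TriMarkedDomain.bcolOf i = false) :
    i = 1 ∨ i = 3 := by
  revert i; decide

/-- **CHIRALITY at the neighbour with partner `p k`** (the tree's `ht3_chi`, Bollobás–Riordan's oriented walk from `y_{p k + 1}`). [cite: BollobasRiordan2006, Ch. 7 Lemma 5 pp. 169–171, Fig. 9] -/
theorem hc_chi (k : Fin 3) : Ht3Chi (p k) (p (k + 1)) (p (k + 2)) := by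
  classical
  intro hcase
  obtain ⟨σ, hσ⟩ := hc_exists_sigma hv hq hp k
  obtain ⟨-, c1, c2⟩ := hc_colours_at_v hv hq hp k hσ
  obtain ⟨-, f2, f4, f21, f41⟩ := hc_fin5_facts (p k)
  set D' := D.forget (p k) with hD'
  set f := D'.ifaceNext σ with hf
  set s₀ := D'.startFace with hs₀def
  obtain ⟨n, hsteps, hend⟩ := exists_partialOrbit_end f (triFacesTouching D'.verts) s₀ D'.startFace_mem
    (fun x _ y hy => D'.ifaceNext_mem hy) (fun x _ x' _ y hy hy' => D'.ifaceNext_injective hy hy')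
    (fun x _ hx => by
      obtain ⟨j, hj, he⟩ := D'.ifaceNext_eq_some hx
      have := D'.isEntry_oppFace hj
      rw [← he] at this
      exact D'.not_isEntry_startFace _ this)
  have hs₀ : s₀ = yc D (p k + 1) := eq_yc D (isCornerFace_startFace D (p k))
  have hadjL : ∀ t, t < n → (sideGraph (ht3Lk ζ v k)).Adj (partialOrbit f s₀ t) (partialOrbit f s₀ (t + 1)) := by
    intro t ht
    obtain ⟨j, hX, he⟩ := D'.ifaceNext_eq_some (hsteps t ht)
    obtain ⟨j', hF', hb⟩ := (iStep_iff D σ (p k) false _ _).1 (iStep_of_isExit D σ (p k) hX)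
    refine ⟨j', by rw [he, ← hF'], ?_⟩
    rw [← hσ]
    exact (mem_xiOf_iff D σ (p k) false _ j').2 hb
  obtain ⟨v₀, j₀, -, -, -, -, -, -, hX₀, -⟩ := D'.exists_isExit_startFace (B := σ)
  have hn : n ≠ 0 := by
    rintro rfl
    exact D'.ifaceNext_ne_none hX₀ hend
  have hend_corner : ∃ m : Fin 5, (m = p k + 2 ∨ m = p k + 4) ∧ IsCornerFace D m (partialOrbit f s₀ n) := by
    obtain ⟨t', ht'⟩ : ∃ t', n = t' + 1 := ⟨n - 1, by omega⟩
    obtain ⟨j', hX, he⟩ := D'.ifaceNext_eq_some (hsteps t' (by omega))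
    have hE : D'.IsEntry σ (partialOrbit f s₀ n) (oppIdx (partialOrbit f s₀ t') j') := by
      rw [ht', he]; exact D'.isEntry_oppFace hX
    obtain ⟨i, w, hw, hw1, hw2, hs1, hs2, hb1, hb2, -, -⟩ :=
      terminal_typeII D σ (p k) hE (fun j'' => D'.ifaceNext_eq_none hend j'')
    set F := partialOrbit f s₀ n with hF
    have hd₁ : (faceVertex F w, faceVertex F (w + 1)) ∈ triBdryDarts D.verts := faceDart_mem₅ hw hw1
    have hd₂ : (faceVertex F w, faceVertex F (w + 2)) ∈ triBdryDarts D.verts := by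
      have e4 : w + 2 + 1 = w := by rw [add_assoc]; exact add_eq_left.2 (by decide)
      have := faceDart_mem₅' (j := w + 2) (by rw [e4]; exact hw) hw2
      rwa [e4] at this
    have hm1 := mem_forget_stretch D (p k) hd₁
    have hm2 := mem_forget_stretch D (p k) hd₂
    rw [hs1] at hm1
    rw [hs2] at hm2
    rcases hc_bcolOf_cases hb1 hb2 with rfl | rfl
    · have g1 := (posIdx_of_mem_forget_stretch D (p k) hm1).1 (by decide)
      have g2 := (posIdx_of_mem_forget_stretch D (p k) hm2).2.1 rfl
      obtain ⟨m, hm, -, hcorner⟩ := typeII_corner D hw hw1 hw2 (by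
        rw [g1, g2]; exact (by decide : ∀ r : Fin 5, r + 1 ≠ r + 2) (p k))
      rw [g2] at hm
      exact ⟨m, Or.inl hm.symm, hcorner⟩
    · have g1 := (posIdx_of_mem_forget_stretch D (p k) hm1).2.2.1 (by decide)
      have g2 := (posIdx_of_mem_forget_stretch D (p k) hm2).2.2.2 rfl
      obtain ⟨m, hm, hm', hcorner⟩ := typeII_corner D hw hw1 hw2 (by
        rw [g1]; rcases g2 with h | h
        · rw [h]; exact (by decide : ∀ r : Fin 5, r + 3 ≠ r + 4) (p k)
        · rw [h]; exact (by decide : ∀ r : Fin 5, r + 3 ≠ r) (p k))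
      have hm4 : m = p k + 4 := by
        rcases g2 with h | h
        · exact hm.symm.trans h
        · exfalso
          rw [g1] at hm'
          rw [← hm, h] at hm'
          exact absurd hm' ((by decide : ∀ r : Fin 5, r + 3 ≠ r - 1) (p k))
      exact ⟨m, Or.inr hm4, hcorner⟩
  -- the corner `y_{p k + 1}` sees no other corner in the core: it is a neighbour's partner
  have hno_corner : ∀ m : Fin 5, m ≠ p k + 1 → ¬ (sideGraph ζ).Reachable (yc D (p k + 1)) (yc D m) := by
    intro m hm
    rcases hcase with e | e
    · rw [e] at hm ⊢; exact hc_partner_blind hv hq hp (k + 1) hm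
    · rw [e] at hm ⊢; exact hc_partner_blind hv hq hp (k + 2) hm
  have hchain : ∀ t, (∀ t', t' ≤ t → t' ≤ n ∧ partialOrbit f s₀ t' ≠ v) → (sideGraph ζ).Reachable s₀ (partialOrbit f s₀ t) := by
    intro t
    induction t with
    | zero => intro _; exact SimpleGraph.Reachable.refl _
    | succ t ih =>
      intro h
      have h' := fun t' (ht' : t' ≤ t) => h t' (by omega)
      exact (ih h').trans (hc_core_adj_of_Lk_adj hv k (hadjL t (by have := (h (t + 1) le_rfl).1; omega))
        (h t (by omega)).2 (h (t + 1) le_rfl).2).reachable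
  have hvisit : ∃ t, t ≤ n ∧ partialOrbit f s₀ t = v := by
    by_contra hno
    push Not at hno
    obtain ⟨m, hm, hcorner⟩ := hend_corner
    have hreach := hchain n (fun t' ht' => ⟨ht', hno t' ht'⟩)
    rw [eq_yc D hcorner, hs₀] at hreach
    have hm1 : m ≠ p k + 1 := by
      rcases hm with rfl | rfl
      · exact f21
      · exact f41
    exact hno_corner m hm1 hreach
  let t₀ := Nat.find hvisit
  have ht₀ : t₀ ≤ n ∧ partialOrbit f s₀ t₀ = v := Nat.find_spec hvisit
  have hmin : ∀ t, t < t₀ → ¬ (t ≤ n ∧ partialOrbit f s₀ t = v) := fun t ht => Nat.find_min hvisit ht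
  have ht₀0 : t₀ ≠ 0 := by
    intro h0
    have hv0 : partialOrbit f s₀ 0 = v := by rw [← h0]; exact ht₀.2
    exact hb_yc_ne_v hv (p k + 1) (hs₀ ▸ hv0)
  obtain ⟨t₁, ht₁⟩ : ∃ t₁, t₀ = t₁ + 1 := ⟨t₀ - 1, by omega⟩
  have hpre : (sideGraph ζ).Reachable s₀ (partialOrbit f s₀ t₁) :=
    hchain t₁ (fun t' ht' => ⟨by omega, fun e => hmin t' (by omega) ⟨by omega, e⟩⟩)
  obtain ⟨j, hX, he⟩ := D'.ifaceNext_eq_some (hsteps t₁ (by omega))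
  have hveq : oppFace (partialOrbit f s₀ t₁) j = v := by rw [← he, ← ht₁]; exact ht₀.2
  have hE : D'.IsEntry σ v (oppIdx (partialOrbit f s₀ t₁) j) := by
    have := D'.isEntry_oppFace hX
    rwa [hveq] at this
  have hidx := hc_entry_idx hv k c1 c2 hE
  have hw : partialOrbit f s₀ t₁ = oppFace v (k + 1) := by
    have := oppFace_oppFace (partialOrbit f s₀ t₁) j
    rw [hveq, hidx] at this
    exact this.symm
  have hreach : (sideGraph ζ).Reachable (oppFace v (k + 1)) (yc D (p k + 1)) := by
    rw [← hs₀, ← hw]; exact hpre.symm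
  exact (hc_opp_corner hv hq hp hreach).symm

/-! #### HT3∂-4. The classes of the three completions; HT3∂; (H∂) for every five-marked domain -/

/-- in the completion at `k` the corners of the two other neighbours are linked through `v`. [cite: KhristoforovSmirnov2021, Lemma 4 (discrete holomorphicity: the triple bijection at a vertex)] -/
private theorem hc_compl_reach_pp (k : Fin 3) :
    (sideGraph (coreCompl v Finset.univ k ζ)).Reachable (yc D (p (k + 1))) (yc D (p (k + 2))) := by
  obtain ⟨-, hside⟩ := hb_core_sub hq
  obtain ⟨hk1, hk2, -⟩ := hc_fin3_ne k
  unfold coreCompl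
  exact (hb_reach_attach hv hside (Finset.univ.erase k) (hb_yc_ne_v hv (p (k + 1))) (yc D (p (k + 2)))).2
    (Or.inl ⟨hb_yc_ne_v hv (p (k + 2)), Or.inr ⟨k + 1, Finset.mem_erase.2 ⟨hk1, Finset.mem_univ _⟩, k + 2,
      Finset.mem_erase.2 ⟨hk2, Finset.mem_univ _⟩, (hp (k + 1)).symm, hp (k + 2)⟩⟩)

omit hv hp in
/-- core links survive in every completion. [cite: KhristoforovSmirnov2021, §1.2 (loop configurations, pp. 3–4)] -/
private theorem hc_compl_reach_of_reach (k : Fin 3) {Y Y' : HexVertex} (h : (sideGraph ζ).Reachable Y Y') :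
    (sideGraph (coreCompl v Finset.univ k ζ)).Reachable Y Y' := by
  have := hq
  unfold coreCompl
  exact h.mono (ht2_sideGraph_mono Finset.subset_union_left)

/-- **class `(p k, A)`** of the completion at `k`. [cite: KhristoforovSmirnov2021, Lemma 4 (discrete holomorphicity: the triple bijection at a vertex)] -/
theorem hc_complClass_A (k : Fin 3)
    (hlink : (sideGraph (coreCompl v Finset.univ k ζ)).Reachable (yc D (p k + 1)) (yc D (p k + 2))) :
    ComplClassb D v Finset.univ k ζ (p k) false := by
  have hmem : coreCompl v Finset.univ k ζ ∈ loopSpace6b D (faceVertex v (k + 1)) (faceVertex v (k + 2)) (coreEnd v Finset.univ k) :=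
    hb_compl_mem hv k Finset.univ ζ hq
  unfold ComplClassb
  rw [hb_inClassb_iff]
  refine ⟨hmem, ?_, ?_⟩
  · unfold coreEnd
    rw [if_pos (Finset.mem_univ k)]
    exact hc_compl_reach_of_reach hq k (hp k)
  · unfold patm
    rw [xiLinked_iff_reachable, if_neg Bool.false_ne_true]
    exact hlink

/-- **class `(p k, B)`** of the completion at `k`. [cite: KhristoforovSmirnov2021, Lemma 4 (discrete holomorphicity: the triple bijection at a vertex)] -/
theorem hc_complClass_B (k : Fin 3)
    (hlink : (sideGraph (coreCompl v Finset.univ k ζ)).Reachable (yc D (p k + 1)) (yc D (p k + 4))) :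
    ComplClassb D v Finset.univ k ζ (p k) true := by
  have hmem : coreCompl v Finset.univ k ζ ∈ loopSpace6b D (faceVertex v (k + 1)) (faceVertex v (k + 2)) (coreEnd v Finset.univ k) :=
    hb_compl_mem hv k Finset.univ ζ hq
  unfold ComplClassb
  rw [hb_inClassb_iff]
  refine ⟨hmem, ?_, ?_⟩
  · unfold coreEnd
    rw [if_pos (Finset.mem_univ k)]
    exact hc_compl_reach_of_reach hq k (hp k)
  · unfold patm
    rw [xiLinked_iff_reachable, if_pos rfl]
    exact hlink

end Reduced

/-- index bookkeeping in `Fin 3` and `Fin 5` for the assembly. [folklore] -/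
private theorem hc_idx :
    ((0 : Fin 3) + 1 = 1 ∧ (0 : Fin 3) + 2 = 2 ∧ (1 : Fin 3) + 1 = 2 ∧ (1 : Fin 3) + 2 = 0 ∧ (2 : Fin 3) + 1 = 0 ∧ (2 : Fin 3) + 2 = 1) ∧
    ∀ c : Fin 5, c + 2 + 1 = c + 3 ∧ c + 2 + 2 = c + 4 ∧ c + 3 + 1 = c + 4 ∧ c + 3 + 4 = c + 2 ∧ c + 4 + 1 = c ∧
      c + 4 + 2 = c + 1 ∧ c + 2 ≠ c + 3 ∧ c + 4 ≠ c + 3 := by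
  refine ⟨by decide, ?_⟩
  decide

/-- three values miss some point of `Fin 5`. [folklore] -/
private theorem hc_fl_free (p₀ p₁ p₂ : Fin 5) : ∃ a : Fin 5, a ≠ p₀ ∧ a ≠ p₁ ∧ a ≠ p₂ := by
  revert p₀ p₁ p₂; decide

/-- the three elements of `Fin 3`. [folklore] -/
private theorem hc_fin3_cases0 (k : Fin 3) : k = 0 ∨ k = 0 + 1 ∨ k = 0 + 2 := by
  revert k; decide

variable (D) in
/-- **HT3∂ `ReLinkingTriplesB` holds for every five-marked domain.** [cite: KhristoforovSmirnov2021, Lemma 4 (discrete holomorphicity: the triple bijection at a vertex)] -/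
theorem reLinkingTriplesB_holds : ReLinkingTriplesB D := by
  classical
  intro v hv ζ hq p hpX
  have hp : ∀ k, (sideGraph ζ).Reachable (oppFace v k) (yc D (p k)) := fun k => (xiLinked_iff_reachable _ _ _).1 (hpX k)
  obtain ⟨⟨i01, i02, i11, i12, i21, i22⟩, hc5⟩ := hc_idx
  obtain ⟨a, ha0, ha1, ha2⟩ := hc_fl_free (p 0) (p 1) (p 2)
  have ha : ∀ k, a ≠ p k := by
    intro k
    rcases hc_fin3_cases0 k with rfl | rfl | rfl
    · exact ha0
    · rw [i01]; exact ha1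
    · rw [i02]; exact ha2
  obtain ⟨b, hba, hb, rab⟩ := hc_free_partner hv hq hp ha
  have hab : a ≠ b := hba.symm
  have hinj := hc_p_injective hv hq hp
  have h01 : p 0 ≠ p 1 := fun e => absurd (hinj e) (by decide)
  have h02 : p 0 ≠ p 2 := fun e => absurd (hinj e) (by decide)
  have h12 : p 1 ≠ p 2 := fun e => absurd (hinj e) (by decide)
  have n0 := hc_nc hv hq hp 0 hab ha hb rab
  have n1 := hc_nc hv hq hp 1 hab ha hb rab
  have n2 := hc_nc hv hq hp 2 hab ha hb rab
  have x0 := hc_chi hv hq hp 0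
  have x1 := hc_chi hv hq hp 1
  have x2 := hc_chi hv hq hp 2
  rw [i01, i02] at n0 x0
  rw [i11, i12] at n1 x1
  rw [i21, i22] at n2 x2
  obtain ⟨c, hab', hrot⟩ := ht3_fl_main (p 0) (p 1) (p 2) a b hab ha0 ha1 ha2 (hb 0) (hb 1) (hb 2) h01 h02 h12
    n0 n1 n2 x0 x1 x2
  obtain ⟨e21, e22, e31, e34, e41, e42, n23, n43⟩ := hc5 c
  have rc : (sideGraph ζ).Reachable (yc D c) (yc D (c + 1)) := by
    rcases hab' with ⟨rfl, rfl⟩ | ⟨rfl, rfl⟩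
    · exact rab
    · exact rab.symm
  obtain ⟨rot, h0, h1, h2⟩ : ∃ rot : Fin 3, p rot = c + 2 ∧ p (rot + 1) = c + 3 ∧ p (rot + 2) = c + 4 := by
    rcases hrot with ⟨e0, e1, e2⟩ | ⟨e1, e2, e0⟩ | ⟨e2, e0, e1⟩
    · exact ⟨0, e0, by rw [i01]; exact e1, by rw [i02]; exact e2⟩
    · exact ⟨1, e1, by rw [i11]; exact e2, by rw [i12]; exact e0⟩
    · exact ⟨2, e2, by rw [i21]; exact e0, by rw [i22]; exact e1⟩
  refine ⟨c, rot, (xiLinked_iff_reachable _ _ _).2 rc, h0, h1, h2, fun k => ?_⟩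
  rcases hc_fin3_cases rot k with hk | hk | hk <;> rw [hk]
  · have hd : decide (p rot = c + 3) = false := by rw [h0]; exact decide_eq_false n23
    rw [hd]
    apply hc_complClass_A hv hq hp rot
    have := hc_compl_reach_pp hv hq hp rot
    rw [h1, h2] at this
    rw [h0, e21, e22]
    exact this
  · have hd : decide (p (rot + 1) = c + 3) = true := by rw [h1]; exact decide_eq_true rfl
    rw [hd]
    apply hc_complClass_B hv hq hp (rot + 1)
    have := hc_compl_reach_pp hv hq hp (rot + 1)
    rw [fin3_add_one_add_one, fin3_add_one_add_two, h2, h0] at this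
    rw [h1, e31, e34]
    exact this
  · have hd : decide (p (rot + 2) = c + 3) = false := by rw [h2]; exact decide_eq_false n43
    rw [hd]
    apply hc_complClass_A hv hq hp (rot + 2)
    rw [h2, e41, e42]
    exact hc_compl_reach_of_reach hq (rot + 2) rc

/-! ## Part D. The theorems -/

/-- **FIVE-POINT DISCRETE HOLOMORPHICITY AT EVERY VERTEX OF `H_G` WITH ALL THREE SIDES IN `H_G`** (interior AND boundary valence-3
vertices of every five-marked domain): `Σ_{k : Fin 3} τ^k · F_j(v, ccwNbr v k) = 0`. [cite: KhristoforovSmirnov2021, §2 Lemma 4 (p. 4), five-disorder analogue at every vertex] -/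
theorem hexFivePointHolomorphy_allSides (D : TriMarkedDomain 5) (c : Bool) (j : Fin 5) (v : HexVertex) (hv : AllSides D v) :
    ∑ k : Fin 3, tau ^ (k : ℕ) * sparseObs D j c v (ccwNbr v k) = 0 :=
  hb_holomorphy_ccw_of_faces (invariantTriplesB_holds D) (reLinkingTriplesB_holds D) hv c j

/-- **(H∂) — the lane's typed target**: the five-point relation at every face of `𝕋` with AT LEAST TWO sites in `G` (Khristoforov–Smirnov's
hypothesis «the three mid-edges at `v` lie in `Ω`»; the tree's interior theorem is the case of three sites). [cite: KhristoforovSmirnov2021, §2 Lemma 4 (p. 4)] -/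
def HexFivePointHolomorphyBdry (D : TriMarkedDomain 5) : Prop :=
  ∀ (c : Bool) (j : Fin 5) (v : HexVertex), 2 ≤ #((hexFaceVertices v).filter (· ∈ D.verts)) →
    ∑ k : Fin 3, tau ^ (k : ℕ) * sparseObs D j c v (ccwNbr v k) = 0

/-- ★ **(H∂) holds for every five-marked domain.** [cite: KhristoforovSmirnov2021, §2 Lemma 4 (p. 4), five-disorder analogue at every vertex] -/
theorem hexFivePointHolomorphyBdry_holds (D : TriMarkedDomain 5) : HexFivePointHolomorphyBdry D :=
  fun c j v h2 => hexFivePointHolomorphy_allSides D c j v (allSides_of_two_le h2)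

/- (The tree's interior theorem `N5.hexFivePointHolomorphy_holds` is the three-sites case: `allSides_of_subset`.) -/

end BdryH

end Literature.Probability.Percolation.FivePoint
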